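import Literature.NumberTheory.LFunctions.FordLemma33
import Literature.NumberTheory.LFunctions.FordLemma34Statement
import Literature.NumberTheory.LFunctions.FordPrimeWindowsPNT
import Mathlib.Data.Nat.Choose.Cast
import HarnessLib

/-!
# Ford's Lemma 3.4 (the step `J_{s,k} → J_{s+k,k}` of Vinogradov's method), proved

Topic `Literature/NumberTheory/LFunctions`. Everything here is PROVED.

K. Ford, Proc. LMS 85 (2002), Lemma 3.4: the iteration of Lemmas 3.2 and 3.3 along
`M_i = P^{φ_i}`, `Q_i = P^{1 − (φ_1 + ⋯ + φ_i)}`, with the prime windows of Lemma 2.1, giving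
`J_{s+k,k}(P) ≤ k^{3k} η^{4s+k²} C P^{2(s+k) − k(k+1)/2 + Δ'}` (`P ≥ V^{k+1}`) from
`J_{s,k}(Q) ≤ C Q^{2s − k(k+1)/2 + Δ}`. We prove it, for `k ≥ 128` and `1/20 ≤ ω ≤ 1/2`
(`η = 1 + ω`; the prime windows `(x, ηx]` of `FordPrimeWindowsPNT.lean` are of this quality), in
the SHARP form that the printed proof actually yields,

`J_{s+k,k}(P) ≤ 4k³ k! · k^{2k} · η^{4s + k² − k + 2} · C · P^{2(s+k) − k(k+1)/2 + Δ'}`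

(`FordVK.ford_lemma34_sharp`), and in the printed form (`FordVK.ford_lemma34`,
`FordVK.lemma34Hyp_of`: the tree's statement `FordP1.Lemma34Hyp k ω` of `FordLemma34Statement.lean`,
consumed by `FordProgram1.lean` / `FordTheorem3SmallK.lean` / `FordTheorem3LargeKOfLemma34.lean`).

Proof = the printed one, with two simplifications that change nothing in the result: (i) the
auxiliary constants `E_J` of (3.10) are replaced by their explicit majorants
`A_J = k^{2k} η^{2s + C(k,2) + (J²+3J+4)/2}` (so that `A_{J−1}² = k^{2k} η^{2s+C(k,2)+C(J,2)} A_J`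
exactly and `A_0 = k^{2k} η^{2s + C(k,2) + 2}` is Ford's bound for `E_0`); (ii) the case
distinction of Lemma 3.3 is resolved by comparing squares. The side facts used: `φ_i ≤ 1/r`
((3.8)), (3.9) in the form `Q_i ≥ P^{1/10} M_{i+1} ≥ 25k⁶ M_{i+1}`, `p^r > P` for `p > M_j`,
`16·4^k k³ k! ≤ k^{2k}` and `4k³k! ≤ k^k` (`k ≥ 128`).

## References

* K. Ford, *Vinogradov's integral and bounds for the Riemann zeta function*, Proc. London Math.
  Soc. (3) 85 (2002), 565–633; arXiv:1910.08209 — Lemma 3.4 and its proof ((3.8)–(3.10)),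
  Lemma 2.1. [Ford2002]
-/

noncomputable section

open Finset MeasureTheory Polynomial
open scoped Real

namespace Literature.NumberTheory.LFunctions
namespace FordVK

open VMV FordP1

/-! ### Arithmetic of the constants -/

/-- `16 k³ ≤ 4^k` for `k ≥ 128`. [folklore] -/
theorem sixteen_mul_cube_le_four_pow {k : ℕ} (hk : 128 ≤ k) : 16 * k ^ 3 ≤ 4 ^ k := by
  induction k, hk using Nat.le_induction with
  | base => norm_num
  | succ k hk ih =>
    have e : (k + 1) ^ 3 = k ^ 3 + 3 * k ^ 2 + 3 * k + 1 := by ring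
    have ha : 3 * k ^ 2 ≤ k ^ 3 := by
      calc 3 * k ^ 2 ≤ k * k ^ 2 := Nat.mul_le_mul_right _ (by omega)
        _ = k ^ 3 := by ring
    have hb : 3 * k ≤ k ^ 3 := by
      calc 3 * k ≤ k * k ^ 2 := Nat.mul_le_mul (by omega) (by nlinarith)
        _ = k ^ 3 := by ring
    have hc : 1 ≤ k ^ 3 := Nat.one_le_pow _ _ (by omega)
    have h1 : (k + 1) ^ 3 ≤ 4 * k ^ 3 := by rw [e]; omega
    calc 16 * (k + 1) ^ 3 ≤ 16 * (4 * k ^ 3) := Nat.mul_le_mul_left 16 h1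
      _ = 4 * (16 * k ^ 3) := by ring
      _ ≤ 4 * 4 ^ k := Nat.mul_le_mul_left 4 ih
      _ = 4 ^ (k + 1) := by rw [pow_succ]; ring

/-- **`16 · 4^k · k³ · k! ≤ k^{2k}`** for `k ≥ 128` (Ford: `4(k³k!)^{1/2} ≤ 2^{−k} k^k`, `k ≥ 8`).
[cite: Ford2002, proof of Lemma 3.4 ("Since r ≤ k and 4(k³k!)^{1/2} ≤ 2^{−k}k^k for k ≥ 8")] -/
theorem sixteen_four_pow_cube_factorial_le {k : ℕ} (hk : 128 ≤ k) :
    16 * 4 ^ k * k ^ 3 * k.factorial ≤ k ^ (2 * k) := by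
  have h1 := sixteen_mul_cube_le_four_pow hk
  have h2 : k.factorial ≤ k ^ k := Nat.factorial_le_pow k
  have h3 : 4 ^ k * 4 ^ k ≤ k ^ k := by
    rw [← mul_pow]; exact Nat.pow_le_pow_left (by omega) k
  calc 16 * 4 ^ k * k ^ 3 * k.factorial = (16 * k ^ 3) * 4 ^ k * k.factorial := by ring
    _ ≤ 4 ^ k * 4 ^ k * k ^ k := by gcongr
    _ ≤ k ^ k * k ^ k := Nat.mul_le_mul_right _ h3
    _ = k ^ (2 * k) := by rw [two_mul, pow_add]

/-- **`4 k³ k! ≤ k^k`** for `k ≥ 128` (Ford: `k ≥ 11`). [cite: Ford2002, proof of Lemma 3.4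
("Lastly, 4k³k! ≤ k^k for k ≥ 11")] -/
theorem four_cube_factorial_le {k : ℕ} (hk : 128 ≤ k) : 4 * k ^ 3 * k.factorial ≤ k ^ k := by
  have h1 : (k - (k - 4)).factorial * k.descFactorial (k - 4) = k.factorial :=
    Nat.factorial_mul_descFactorial (Nat.sub_le _ _)
  rw [show k - (k - 4) = 4 by omega] at h1
  have h2 : k.descFactorial (k - 4) ≤ k ^ (k - 4) := Nat.descFactorial_le_pow _ _
  have h4 : (4 : ℕ).factorial = 24 := by decide
  calc 4 * k ^ 3 * k.factorial = 4 * k ^ 3 * (24 * k.descFactorial (k - 4)) := by rw [← h1, h4]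
    _ ≤ 4 * k ^ 3 * (24 * k ^ (k - 4)) := by gcongr
    _ = 96 * (k ^ 3 * k ^ (k - 4)) := by ring
    _ = 96 * k ^ (k - 1) := by rw [← pow_add]; congr 2; omega
    _ ≤ k * k ^ (k - 1) := Nat.mul_le_mul_right _ (by omega)
    _ = k ^ k := by rw [← pow_succ']; congr 1; omega

/-- The exponent `g(J) = (J² + 3J + 4)/2` of the majorant `A_J` of Ford's `E_J`. [folklore] -/
def gq (J : ℕ) : ℕ := (J * (J + 3) + 4) / 2

/-- `2 g(J) = J² + 3J + 4`. [folklore] -/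
theorem two_mul_gq (J : ℕ) : 2 * gq J = J * (J + 3) + 4 := by
  obtain ⟨t, ht⟩ := Nat.even_mul_succ_self J
  have e : J * (J + 3) + 4 = 2 * (t + J + 2) := by nlinarith [ht]
  rw [gq, e, Nat.mul_div_cancel_left _ (by norm_num)]

/-- `g(0) = 2`. [folklore] -/
theorem gq_zero : gq 0 = 2 := by decide

/-- The recursion `C(J+1, 2) + g(J+1) = 2 g(J)` (i.e. `A_J² = k^{2k} η^{2s + C(k,2) + C(J+1,2)} A_{J+1}`).
[folklore] -/
theorem choose_two_add_gq (J : ℕ) : (J + 1).choose 2 + gq (J + 1) = 2 * gq J := by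
  have h1 := choose_two_mul_two (J + 1)
  have h2 := two_mul_gq (J + 1)
  have h3 := two_mul_gq J
  rw [Nat.add_sub_cancel] at h1
  set t := J * J with ht
  have e1 : (J + 1) * J = t + J := by rw [ht]; ring
  have e2 : (J + 1) * (J + 1 + 3) + 4 = t + 5 * J + 8 := by rw [ht]; ring
  have e3 : J * (J + 3) + 4 = t + 3 * J + 4 := by rw [ht]; ring
  omega

/-- `(21/20)^63 ≥ 4`. [folklore] -/
theorem four_le_pow_63 : (4 : ℝ) ≤ (21 / 20 : ℝ) ^ 63 := by norm_num

/-! ### The exponents `φ_i` -/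

section Phi

variable {k r j : ℕ} {Δ : ℝ}

/-- **`φ_i ≤ 1/r`** for `1 ≤ i ≤ j`, from (3.8) and `φ_i ≥ 0`. [cite: Ford2002, proof of Lemma 3.4
("By (3.8), φ_i ≤ 1/r for each i")] -/
theorem phiF_le_inv (hk : 1 ≤ k) (hr : 1 ≤ r)
    (h38 : ((j : ℝ) - 1) * ((j : ℝ) - 2) ≤ 2 * Δ - ((k : ℝ) - r) * ((k : ℝ) - r + 1))
    (hφ : ∀ J : ℕ, 1 ≤ J → J ≤ j → 0 ≤ phiF k r Δ j J) :
    ∀ J : ℕ, 1 ≤ J → J ≤ j → phiF k r Δ j J ≤ 1 / r := by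
  have hr0 : (0 : ℝ) < r := by exact_mod_cast hr
  have hk0 : (0 : ℝ) < k := by exact_mod_cast hk
  -- downward induction: `J = j - m`
  suffices h : ∀ m : ℕ, m < j → phiF k r Δ j (j - m) ≤ 1 / r by
    intro J hJ1 hJj
    have := h (j - J) (by omega)
    rwa [show j - (j - J) = J by omega] at this
  intro m
  induction m with
  | zero => intro _; rw [Nat.sub_zero, phiF_self]
  | succ m ih =>
    intro hm
    have hJ1 : 1 ≤ j - (m + 1) := by omega
    have hJ : j - (m + 1) < j := by omega
    rw [phiF_rec (k : ℝ) r Δ j hJ1 hJ]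
    have e : j - (m + 1) + 1 = j - m := by omega
    rw [e]
    have hih := ih (by omega)
    have hpos := hφ (j - m) (by omega) (by omega)
    set J := j - (m + 1) with hJdef
    set y := 2 * Δ - ((k : ℝ) - r) * ((k : ℝ) - r + 1) with hy
    -- `J² − J ≤ (j−1)(j−2) ≤ y`
    have hJy : (J : ℝ) ^ 2 - J ≤ y := by
      have h1 : (J : ℝ) + 1 ≤ j := by exact_mod_cast (show J + 1 ≤ j by omega)
      have h2 : (1 : ℝ) ≤ J := by exact_mod_cast hJ1
      nlinarith
    have hcoef : (2 * (k : ℝ) * r + (J : ℝ) ^ 2 - J - y) / (4 * k * r) ≤ 1 / 2 := by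
      rw [div_le_iff₀ (by positivity)]; nlinarith
    have hprod : (2 * (k : ℝ) * r + (J : ℝ) ^ 2 - J - y) / (4 * k * r) * phiF (k : ℝ) r Δ j (j - m)
        ≤ 1 / 2 * (1 / r) := by
      rcases le_or_gt 0 ((2 * (k : ℝ) * r + (J : ℝ) ^ 2 - J - y) / (4 * k * r)) with hc | hc
      · exact mul_le_mul hcoef hih hpos (by norm_num)
      · have : (2 * (k : ℝ) * r + (J : ℝ) ^ 2 - J - y) / (4 * k * r) * phiF (k : ℝ) r Δ j (j - m) ≤ 0 :=
          mul_nonpos_of_nonpos_of_nonneg hc.le hpos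
        have : (0 : ℝ) ≤ 1 / 2 * (1 / r) := by positivity
        linarith
    calc 1 / (2 * (r : ℝ)) + (2 * (k : ℝ) * r + (J : ℝ) ^ 2 - J - y) / (4 * k * r) * phiF (k : ℝ) r Δ j (j - m)
        ≤ 1 / (2 * (r : ℝ)) + 1 / 2 * (1 / r) := by linarith
      _ = 1 / r := by field_simp; ring

end Phi

/-! ### `L_s ≤ P^k J_{s,k}(Q)` when `p^r ≥ P` -/

/-- If `p^r ≥ P` then in (3.2) every `w_i = z_i`, so `L_s(P,Q;Φ;p,q,r) ≤ P^k J_{s,k}(Q)`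
(`pq ≠ 0`). [cite: Ford2002, proof of Lemma 3.4 ("when J = j−1, we have p^r > M_{j−1}^r ≥ P, so
that in (3.2), w_i = z_i for every i")] -/
theorem Ls_le_pow_mul_J {k : ℕ} (s P Q : ℕ) (Φ : PSystem k) {p : ℕ} {q : ℤ} (r : ℕ)
    (hpq : (p : ℤ) * q ≠ 0) (hP : (P : ℤ) ≤ (p : ℤ) ^ r) :
    Ls s P Q Φ p q r ≤ P ^ k * J k s (Finset.Icc (1 : ℤ) Q) := by
  classical
  unfold Ls J Jc
  set IP := Finset.Icc 1 (P : ℤ) with hIP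
  set IQ := Finset.Icc 1 (Q : ℤ) with hIQ
  have hcard : P ^ k * ((tuples s IQ ×ˢ tuples s IQ).filter fun xy => psv k xy.1 = psv k xy.2 + 0).card
      = ((tuples k IP) ×ˢ ((tuples s IQ ×ˢ tuples s IQ).filter fun xy => psv k xy.1 = psv k xy.2 + 0)).card := by
    rw [card_product, card_tuples, Int.card_Icc]; simp
  rw [hcard]
  refine Finset.card_le_card_of_injOn (fun w => (w.1.1, (w.1.2, w.2.2))) ?_ ?_
  · intro w hw
    rw [mem_coe, mem_filter, mem_product, mem_KI, mem_KI] at hw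
    obtain ⟨⟨⟨hz, hx⟩, hw', hy⟩, heq, hcong⟩ := hw
    -- all `z_i = w_i`
    have hzw : w.1.1 = w.2.1 := by
      funext i
      have h1 := hz i; have h2 := hw' i
      rw [Finset.mem_Icc] at h1 h2
      have habs : |w.1.1 i - w.2.1 i| < (p : ℤ) ^ r := by
        rw [abs_lt]; constructor <;> linarith
      exact sub_eq_zero.1 (Int.eq_zero_of_abs_lt_dvd (hcong i) habs)
    rw [mem_coe, mem_product, mem_filter, mem_product, mem_tuples, mem_tuples, mem_tuples]
    refine ⟨hz, ⟨hx, hy⟩, ?_⟩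
    rw [add_zero, ← tupSum_powv_eq_iff hpq]
    simp only [Kfreq] at heq
    rw [hzw] at heq
    exact add_left_cancel heq
  · intro a ha b hb hab
    rw [mem_coe, mem_filter, mem_product, mem_KI, mem_KI] at ha hb
    simp only [Prod.mk.injEq] at hab
    obtain ⟨hz, hx, hy⟩ := hab
    have hza : a.1.1 = a.2.1 := by
      funext i
      have h1 := ha.1.1.1 i; have h2 := ha.1.2.1 i
      rw [Finset.mem_Icc] at h1 h2
      have habs : |a.1.1 i - a.2.1 i| < (p : ℤ) ^ r := by
        rw [abs_lt]; constructor <;> linarith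
      exact sub_eq_zero.1 (Int.eq_zero_of_abs_lt_dvd (ha.2.2 i) habs)
    have hzb : b.1.1 = b.2.1 := by
      funext i
      have h1 := hb.1.1.1 i; have h2 := hb.1.2.1 i
      rw [Finset.mem_Icc] at h1 h2
      have habs : |b.1.1 i - b.2.1 i| < (p : ℤ) ^ r := by
        rw [abs_lt]; constructor <;> linarith
      exact sub_eq_zero.1 (Int.eq_zero_of_abs_lt_dvd (hb.2.2 i) habs)
    refine Prod.ext (Prod.ext hz hx) (Prod.ext ?_ hy)
    rw [← hza, ← hzb, hz]

/-- `k(k−1) + 2 ≤ k²` for `k ≥ 2`. [folklore] -/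
theorem mul_pred_add_two_le_sq (k : ℕ) (hk : 2 ≤ k) : k * (k - 1) + 2 ≤ k ^ 2 := by
  obtain ⟨t, rfl⟩ : ∃ t, k = t + 2 := ⟨k - 2, by omega⟩
  rw [show t + 2 - 1 = t + 1 by omega]; nlinarith

/-! ### The data of Lemma 3.4 and the derived quantities -/

/-- The data and hypotheses of Lemma 3.4 (with `k = k' + 2 ≥ 128`, `s = nk`, `1/20 ≤ ω ≤ 1/2`,
`P ≥ V^{k+1}`). [cite: Ford2002, Lemma 3.4 (hypotheses)] -/
structure L34Ctx where
  /-- `k = k' + 2` -/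
  k' : ℕ
  /-- `s = nk` -/
  n : ℕ
  /-- Ford's `r` -/
  r : ℕ
  /-- Ford's `j` -/
  j : ℕ
  /-- Ford's `P` -/
  P : ℕ
  /-- `η = 1 + ω` -/
  ω : ℝ
  /-- Ford's `Δ` -/
  Δ : ℝ
  /-- Ford's `C` -/
  C : ℝ
  hk : 128 ≤ k' + 2
  hω1 : 1 / 20 ≤ ω
  hω2 : ω ≤ 1 / 2
  hn : 1 ≤ n
  hnk : n * (k' + 2) ≤ (k' + 2) ^ 3
  hr4 : 4 ≤ r
  hrk : r ≤ k' + 2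
  hj2 : 2 ≤ j
  hjr : 10 * j ≤ 9 * r
  h38 : ((j : ℝ) - 1) * ((j : ℝ) - 2) ≤ 2 * Δ - (((k' + 2 : ℕ) : ℝ) - r) * (((k' + 2 : ℕ) : ℝ) - r + 1)
  hφ : ∀ J : ℕ, 1 ≤ J → J ≤ j → 1 / (((k' + 2 : ℕ) : ℝ) + 1) ≤ phiF ((k' + 2 : ℕ) : ℝ) r Δ j J
  hJ : ∀ Q : ℕ, 1 ≤ Q →
    (VMV.J (k' + 2) (n * (k' + 2)) (Finset.Icc (1 : ℤ) Q) : ℝ) ≤ C * (Q : ℝ) ^ expo (k' + 2) n Δ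
  hP : Vf (k' + 2) ω ^ (k' + 2 + 1) ≤ (P : ℝ)

namespace L34Ctx

variable (c : L34Ctx)

/-- `k`. [cite: Ford2002, Lemma 3.4] -/
abbrev k : ℕ := c.k' + 2
/-- `s = nk`. [cite: Ford2002, Lemma 3.5 (`s = nk` in Lemma 3.4)] -/
def s : ℕ := c.n * c.k
/-- `η = 1 + ω`. [cite: Ford2002, Lemma 3.4] -/
def η : ℝ := 1 + c.ω
/-- `φ_J`. [cite: Ford2002, Lemma 3.4] -/
def φ (J : ℕ) : ℝ := phiF (c.k : ℝ) c.r c.Δ c.j J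
/-- `φ_1 + ⋯ + φ_i`. [cite: Ford2002, proof of Lemma 3.4 (`Q_i`)] -/
def Sφ (i : ℕ) : ℝ := ∑ l ∈ Finset.Icc 1 i, c.φ l
/-- `P` as a real number. [folklore] -/
def Pr : ℝ := (c.P : ℝ)
/-- `M_i = P^{φ_i}`. [cite: Ford2002, proof of Lemma 3.4] -/
def M (i : ℕ) : ℝ := c.Pr ^ c.φ i
/-- `Q_i = P^{1 − (φ_1 + ⋯ + φ_i)}`. [cite: Ford2002, proof of Lemma 3.4] -/
def Qr (i : ℕ) : ℝ := c.Pr ^ (1 - c.Sφ i)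
/-- `⌊Q_i⌋`. [folklore] -/
def Qn (i : ℕ) : ℕ := ⌊c.Qr i⌋₊
/-- `λ = 2s − k(k+1)/2 + Δ`. [cite: Ford2002, proof of Lemma 3.4] -/
def lam : ℝ := expo c.k c.n c.Δ
/-- The majorant `A_J = k^{2k} η^{2s + C(k,2) + g(J)}` of Ford's `E_J`. [cite: Ford2002, proof of
Lemma 3.4 ((3.10) and the bound for `E_0`)] -/
def A (J : ℕ) : ℝ := (c.k : ℝ) ^ (2 * c.k) * c.η ^ (2 * c.s + (c.k).choose 2 + gq J)
/-- `V`. [cite: Ford2002, Lemma 3.4] -/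
def V : ℝ := Vf c.k c.ω

/-! #### Elementary sizes -/

/-- Auxiliary step (elementary consequence of the definitions and the standing hypotheses). [folklore] -/
theorem k_def : c.k = c.k' + 2 := rfl
/-- Auxiliary step (elementary consequence of the definitions and the standing hypotheses). [folklore] -/
theorem k_ge : 128 ≤ c.k := c.hk
/-- Auxiliary step (elementary consequence of the definitions and the standing hypotheses). [folklore] -/
theorem one_le_k : 1 ≤ c.k := le_trans (by norm_num) c.hk
/-- Auxiliary step (elementary consequence of the definitions and the standing hypotheses). [folklore] -/
theorem k_geR : (128 : ℝ) ≤ c.k := by exact_mod_cast c.k_ge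
/-- Auxiliary step (elementary consequence of the definitions and the standing hypotheses). [folklore] -/
theorem k_pos : (0 : ℝ) < c.k := by linarith [c.k_geR]
/-- Auxiliary step (elementary consequence of the definitions and the standing hypotheses). [folklore] -/
theorem k_le_s : c.k ≤ c.s := by
  unfold s
  calc c.k = 1 * c.k := (one_mul _).symm
    _ ≤ c.n * c.k := Nat.mul_le_mul_right _ c.hn
/-- Auxiliary step (elementary consequence of the definitions and the standing hypotheses). [folklore] -/
theorem one_le_s : 1 ≤ c.s := le_trans c.one_le_k c.k_le_s
/-- Auxiliary step (elementary consequence of the definitions and the standing hypotheses). [folklore] -/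
theorem s_le : c.s ≤ c.k ^ 3 := c.hnk
/-- Auxiliary step (elementary consequence of the definitions and the standing hypotheses). [folklore] -/
theorem η_ge : (21 / 20 : ℝ) ≤ c.η := by unfold η; linarith [c.hω1]
/-- Auxiliary step (elementary consequence of the definitions and the standing hypotheses). [folklore] -/
theorem η_le : c.η ≤ 3 / 2 := by unfold η; linarith [c.hω2]
/-- Auxiliary step (elementary consequence of the definitions and the standing hypotheses). [folklore] -/
theorem one_le_η : (1 : ℝ) ≤ c.η := by linarith [c.η_ge]
/-- Auxiliary step (elementary consequence of the definitions and the standing hypotheses). [folklore] -/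
theorem one_le_η_pow (n : ℕ) : (1 : ℝ) ≤ c.η ^ n := by
  have := pow_le_pow_left₀ zero_le_one c.one_le_η n; rwa [one_pow] at this
/-- Auxiliary step (elementary consequence of the definitions and the standing hypotheses). [folklore] -/
theorem η_pos : (0 : ℝ) < c.η := by linarith [c.η_ge]
/-- Auxiliary step (elementary consequence of the definitions and the standing hypotheses). [folklore] -/
theorem ω_pos : (0 : ℝ) < c.ω := by linarith [c.hω1]
/-- Auxiliary step (elementary consequence of the definitions and the standing hypotheses). [folklore] -/
theorem r_pos : (0 : ℝ) < c.r := by have := c.hr4; exact_mod_cast (show 0 < c.r by omega)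
/-- Auxiliary step (elementary consequence of the definitions and the standing hypotheses). [folklore] -/
theorem one_le_j : 1 ≤ c.j := le_trans (by norm_num) c.hj2
/-- Auxiliary step (elementary consequence of the definitions and the standing hypotheses). [folklore] -/
theorem j_lt_r : c.j < c.r := by have := c.hjr; have := c.hr4; omega

/-- `log k ≥ 1`. [folklore] -/
theorem one_le_log_k : (1 : ℝ) ≤ Real.log c.k := by
  rw [Real.le_log_iff_exp_le (by linarith [c.k_geR])]
  have := Real.exp_one_lt_d9
  linarith [c.k_geR]

/-- `V ≥ 18 k³`. [cite: Ford2002, Lemma 3.4 (definition of `V`)] -/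
theorem V_ge : 18 * (c.k : ℝ) ^ 3 ≤ c.V := by
  unfold V Vf
  refine le_trans ?_ (le_max_right _ _)
  have h1 : (18 : ℝ) ≤ 18 / c.ω := by
    rw [le_div_iff₀ c.ω_pos]; nlinarith [c.hω2]
  have hk3 : (0 : ℝ) ≤ (c.k : ℝ) ^ 3 := by positivity
  calc 18 * (c.k : ℝ) ^ 3 = 18 * (c.k : ℝ) ^ 3 * 1 := by ring
    _ ≤ 18 / c.ω * (c.k : ℝ) ^ 3 * Real.log c.k := by
        refine mul_le_mul (mul_le_mul_of_nonneg_right h1 hk3) c.one_le_log_k zero_le_one ?_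
        have := c.ω_pos; positivity

/-- Auxiliary step (elementary consequence of the definitions and the standing hypotheses). [folklore] -/
theorem one_le_V : (1 : ℝ) ≤ c.V := by
  have := c.V_ge; have := c.k_geR; nlinarith [pow_le_pow_left₀ (by norm_num : (0:ℝ) ≤ 128) c.k_geR 3]

/-- Auxiliary step (elementary consequence of the definitions and the standing hypotheses). [folklore] -/
theorem V_pos : (0 : ℝ) < c.V := by linarith [c.one_le_V]

/-- `P ≥ V^{k+1}`. [cite: Ford2002, Lemma 3.4 ("If P ≥ V^{k+1}")] -/
theorem Pr_ge : c.V ^ (c.k + 1) ≤ c.Pr := c.hP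

/-- Auxiliary step (elementary consequence of the definitions and the standing hypotheses). [folklore] -/
theorem V_le_Pr : c.V ≤ c.Pr := by
  refine le_trans ?_ c.Pr_ge
  calc c.V = c.V ^ 1 := (pow_one _).symm
    _ ≤ c.V ^ (c.k + 1) := pow_le_pow_right₀ c.one_le_V (by omega)

/-- Auxiliary step (elementary consequence of the definitions and the standing hypotheses). [folklore] -/
theorem one_lt_Pr : (1 : ℝ) < c.Pr := by
  have := c.V_le_Pr; have := c.V_ge; have := c.k_geR
  nlinarith [pow_le_pow_left₀ (by norm_num : (0:ℝ) ≤ 128) c.k_geR 3]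

/-- Auxiliary step (elementary consequence of the definitions and the standing hypotheses). [folklore] -/
theorem one_le_Pr : (1 : ℝ) ≤ c.Pr := c.one_lt_Pr.le
/-- Auxiliary step (elementary consequence of the definitions and the standing hypotheses). [folklore] -/
theorem Pr_pos : (0 : ℝ) < c.Pr := by linarith [c.one_lt_Pr]
/-- Auxiliary step (elementary consequence of the definitions and the standing hypotheses). [folklore] -/
theorem one_le_P : 1 ≤ c.P := by
  have := c.one_le_Pr; unfold Pr at this; exact_mod_cast this

/-- `P > 4k⁴`. [cite: Ford2002, Lemma 3.2 (hypothesis, via `P ≥ V^{k+1}`)] -/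
theorem four_k4_lt_P : 4 * c.k ^ 4 < c.P := by
  have h1 : (4 : ℝ) * (c.k : ℝ) ^ 4 < 18 * (c.k : ℝ) ^ 3 * (18 * (c.k : ℝ) ^ 3) := by
    have h46 : (c.k : ℝ) ^ 4 ≤ (c.k : ℝ) ^ 6 := pow_le_pow_right₀ (by linarith [c.k_geR]) (by norm_num)
    nlinarith [pow_pos c.k_pos 4]
  have h2 : 18 * (c.k : ℝ) ^ 3 * (18 * (c.k : ℝ) ^ 3) ≤ c.V ^ 2 := by
    rw [sq]; have := c.V_ge
    exact mul_le_mul this this (by positivity) c.V_pos.le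
  have h3 : c.V ^ 2 ≤ c.V ^ (c.k + 1) := pow_le_pow_right₀ c.one_le_V (by have := c.k_ge; omega)
  have : (4 : ℝ) * (c.k : ℝ) ^ 4 < c.Pr := by linarith [c.Pr_ge]
  unfold Pr at this
  exact_mod_cast this

/-! #### `φ`, `Sφ` -/

/-- Auxiliary step (elementary consequence of the definitions and the standing hypotheses). [folklore] -/
theorem φ_ge {J : ℕ} (h1 : 1 ≤ J) (h2 : J ≤ c.j) : 1 / ((c.k : ℝ) + 1) ≤ c.φ J := c.hφ J h1 h2

/-- Auxiliary step (elementary consequence of the definitions and the standing hypotheses). [folklore] -/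
theorem φ_pos {J : ℕ} (h1 : 1 ≤ J) (h2 : J ≤ c.j) : 0 < c.φ J :=
  lt_of_lt_of_le (by have := c.k_pos; positivity) (c.φ_ge h1 h2)

/-- Auxiliary step (elementary consequence of the definitions and the standing hypotheses). [folklore] -/
theorem φ_le {J : ℕ} (h1 : 1 ≤ J) (h2 : J ≤ c.j) : c.φ J ≤ 1 / c.r :=
  phiF_le_inv (k := c.k) (r := c.r) (j := c.j) (Δ := c.Δ) c.one_le_k (le_trans (by norm_num) c.hr4) c.h38
    (fun J h1 h2 => (c.φ_pos h1 h2).le) J h1 h2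

/-- Auxiliary step (elementary consequence of the definitions and the standing hypotheses). [folklore] -/
theorem φ_j : c.φ c.j = 1 / c.r := phiF_self _ _ _ _

/-- Auxiliary step (elementary consequence of the definitions and the standing hypotheses). [folklore] -/
theorem Sφ_zero : c.Sφ 0 = 0 := by unfold Sφ; simp

/-- Auxiliary step (elementary consequence of the definitions and the standing hypotheses). [folklore] -/
theorem Sφ_succ (i : ℕ) : c.Sφ (i + 1) = c.Sφ i + c.φ (i + 1) := by
  unfold Sφ; rw [Finset.sum_Icc_succ_top (by omega)]

/-- Auxiliary step (elementary consequence of the definitions and the standing hypotheses). [folklore] -/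
theorem Sφ_one : c.Sφ 1 = c.φ 1 := by rw [c.Sφ_succ 0, c.Sφ_zero, zero_add]

/-- `φ_1 + ⋯ + φ_i ≤ i/r` (`i ≤ j`). [cite: Ford2002, (3.9) ("Q_{j−1} ≥ P^{1−(j−1)/r}")] -/
theorem Sφ_le {i : ℕ} (hi : i ≤ c.j) : c.Sφ i ≤ i / c.r := by
  induction i with
  | zero => rw [c.Sφ_zero]; simp
  | succ i ih =>
    rw [c.Sφ_succ]
    have := ih (by omega); have := c.φ_le (J := i + 1) (by omega) hi
    push_cast; rw [add_div]; linarith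

/-- Auxiliary step (elementary consequence of the definitions and the standing hypotheses). [folklore] -/
theorem Sφ_nonneg {i : ℕ} (hi : i ≤ c.j) : 0 ≤ c.Sφ i := by
  unfold Sφ
  exact Finset.sum_nonneg fun l hl => by
    rw [Finset.mem_Icc] at hl; exact (c.φ_pos hl.1 (hl.2.trans hi)).le

/-- **(3.9)**: `1 − (φ_1 + ⋯ + φ_i) ≥ 1/10 + 1/r` for `i ≤ j − 1`. [cite: Ford2002, (3.9)] -/
theorem one_sub_Sφ_ge {i : ℕ} (hi : i + 1 ≤ c.j) : 1 / 10 + 1 / c.r ≤ 1 - c.Sφ i := by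
  have h1 := c.Sφ_le (i := i) (by omega)
  have h2 : ((i : ℝ) + 1) * 10 ≤ 9 * c.r := by
    have : (i + 1) * 10 ≤ 9 * c.r := le_trans (Nat.mul_le_mul_right 10 hi) (by have := c.hjr; linarith)
    exact_mod_cast this
  have hr := c.r_pos
  have h3 : (i : ℝ) / c.r ≤ 9 / 10 - 1 / c.r := by
    rw [div_le_iff₀ hr, sub_mul, div_mul_cancel₀ _ hr.ne']; nlinarith
  linarith

/-- Auxiliary step (elementary consequence of the definitions and the standing hypotheses). [folklore] -/
theorem one_sub_Sφ_ge' {i : ℕ} (hi : i ≤ c.j) : 1 / 10 ≤ 1 - c.Sφ i := by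
  have h1 := c.Sφ_le hi
  have h2 : (c.j : ℝ) * 10 ≤ 9 * c.r := by exact_mod_cast (show c.j * 10 ≤ 9 * c.r by have := c.hjr; linarith)
  have hr := c.r_pos
  have h3 : (i : ℝ) / c.r ≤ 9 / 10 := by
    rw [div_le_iff₀ hr]
    have : (i : ℝ) ≤ c.j := by exact_mod_cast hi
    nlinarith
  linarith

/-! #### `M_i`, `Q_i` -/

/-- Auxiliary step (elementary consequence of the definitions and the standing hypotheses). [folklore] -/
theorem M_pos (i : ℕ) : 0 < c.M i := Real.rpow_pos_of_pos c.Pr_pos _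

/-- Auxiliary step (elementary consequence of the definitions and the standing hypotheses). [folklore] -/
theorem one_le_M {i : ℕ} (h1 : 1 ≤ i) (h2 : i ≤ c.j) : 1 ≤ c.M i :=
  Real.one_le_rpow c.one_le_Pr (c.φ_pos h1 h2).le

/-- `M_i ≥ V` (`M_i = P^{φ_i} ≥ P^{1/(k+1)} ≥ V`). [cite: Ford2002, proof of Lemma 3.4 ("By hypothesis, M_i ≥ V")] -/
theorem V_le_M {i : ℕ} (h1 : 1 ≤ i) (h2 : i ≤ c.j) : c.V ≤ c.M i := by
  have h3 : c.Pr ^ (1 / ((c.k : ℝ) + 1)) ≤ c.M i :=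
    Real.rpow_le_rpow_of_exponent_le c.one_le_Pr (c.φ_ge h1 h2)
  refine le_trans ?_ h3
  have h4 : (c.V ^ (c.k + 1)) ^ (1 / ((c.k : ℝ) + 1)) ≤ c.Pr ^ (1 / ((c.k : ℝ) + 1)) :=
    Real.rpow_le_rpow (by have := c.V_pos; positivity) c.Pr_ge (by have := c.k_pos; positivity)
  refine le_trans (le_of_eq ?_) h4
  rw [one_div, show ((c.k : ℝ) + 1) = ((c.k + 1 : ℕ) : ℝ) by push_cast; ring,
    Real.pow_rpow_inv_natCast c.V_pos.le (by omega)]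

/-- Primes above `M_i` exceed `k`. [folklore] -/
theorem k_lt_of_M_lt {i p : ℕ} (h1 : 1 ≤ i) (h2 : i ≤ c.j) (hp : c.M i < p) : c.k < p := by
  have := c.V_le_M h1 h2; have := c.V_ge; have := c.k_geR
  have hk3 : (c.k : ℝ) ≤ (c.k : ℝ) ^ 3 := le_self_pow₀ (by linarith) (by norm_num)
  have : (c.k : ℝ) < p := by nlinarith
  exact_mod_cast this

/-- Auxiliary step (elementary consequence of the definitions and the standing hypotheses). [folklore] -/
theorem Qr_zero : c.Qr 0 = c.Pr := by unfold Qr; rw [c.Sφ_zero, sub_zero, Real.rpow_one]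

/-- Auxiliary step (elementary consequence of the definitions and the standing hypotheses). [folklore] -/
theorem Qn_zero : c.Qn 0 = c.P := by unfold Qn; rw [c.Qr_zero]; unfold Pr; exact Nat.floor_natCast _

/-- Auxiliary step (elementary consequence of the definitions and the standing hypotheses). [folklore] -/
theorem Qr_pos (i : ℕ) : 0 < c.Qr i := Real.rpow_pos_of_pos c.Pr_pos _

/-- `Q_{i+1} M_{i+1} = Q_i`. [cite: Ford2002, proof of Lemma 3.4 (definition of `Q_i`, `M_i`)] -/
theorem Qr_succ_mul_M (i : ℕ) : c.Qr (i + 1) * c.M (i + 1) = c.Qr i := by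
  unfold Qr M; rw [c.Sφ_succ, ← Real.rpow_add c.Pr_pos]; congr 1; ring

/-- Auxiliary step (elementary consequence of the definitions and the standing hypotheses). [folklore] -/
theorem Qr_succ (i : ℕ) : c.Qr (i + 1) = c.Qr i / c.M (i + 1) := by
  rw [← c.Qr_succ_mul_M i, mul_div_cancel_right₀ _ (c.M_pos _).ne']

/-- Auxiliary step (elementary consequence of the definitions and the standing hypotheses). [folklore] -/
theorem one_le_Qr {i : ℕ} (hi : i ≤ c.j) : 1 ≤ c.Qr i :=
  Real.one_le_rpow c.one_le_Pr (by linarith [c.one_sub_Sφ_ge' hi])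

/-- Auxiliary step (elementary consequence of the definitions and the standing hypotheses). [folklore] -/
theorem one_le_Qn {i : ℕ} (hi : i ≤ c.j) : 1 ≤ c.Qn i := Nat.le_floor (by exact_mod_cast c.one_le_Qr hi)

/-- Auxiliary step (elementary consequence of the definitions and the standing hypotheses). [folklore] -/
theorem Qn_le_Qr (i : ℕ) : (c.Qn i : ℝ) ≤ c.Qr i := Nat.floor_le (c.Qr_pos i).le

/-- `P^{1/10} ≥ 25 k⁶`. [cite: Ford2002, (3.9) ("V^{k/10} > k^8 > 32 s²")] -/
theorem Pr_tenth_ge : 25 * (c.k : ℝ) ^ 6 ≤ c.Pr ^ (1 / 10 : ℝ) := by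
  have h1 : (c.V ^ (c.k + 1)) ^ (1 / 10 : ℝ) ≤ c.Pr ^ (1 / 10 : ℝ) :=
    Real.rpow_le_rpow (by have := c.V_pos; positivity) c.Pr_ge (by norm_num)
  refine le_trans ?_ h1
  rw [← Real.rpow_natCast c.V (c.k + 1), ← Real.rpow_mul c.V_pos.le]
  have h2 : c.V ^ (12 : ℝ) ≤ c.V ^ (((c.k + 1 : ℕ) : ℝ) * (1 / 10)) := by
    refine Real.rpow_le_rpow_of_exponent_le c.one_le_V ?_
    have := c.k_geR
    push_cast at this ⊢; linarith
  refine le_trans ?_ h2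
  rw [show (12 : ℝ) = ((12 : ℕ) : ℝ) by norm_num, Real.rpow_natCast]
  have h3 : (18 * (c.k : ℝ) ^ 3) ^ 12 ≤ c.V ^ 12 := pow_le_pow_left₀ (by positivity) c.V_ge 12
  refine le_trans ?_ h3
  have hk := c.k_geR
  have hk1 : (1 : ℝ) ≤ c.k := by linarith
  calc 25 * (c.k : ℝ) ^ 6 ≤ 18 ^ 12 * (c.k : ℝ) ^ 6 := by nlinarith [pow_nonneg c.k_pos.le 6]
    _ ≤ 18 ^ 12 * (c.k : ℝ) ^ 36 := by
        refine mul_le_mul_of_nonneg_left (pow_le_pow_right₀ hk1 (by norm_num)) (by norm_num)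
    _ = (18 * (c.k : ℝ) ^ 3) ^ 12 := by ring

/-- **(3.9)**: `Q_i ≥ P^{1/10} M_{i+1} ≥ 25 k⁶ M_{i+1}` for `i ≤ j − 1`. [cite: Ford2002, (3.9)] -/
theorem Qr_ge {i : ℕ} (hi : i + 1 ≤ c.j) : 25 * (c.k : ℝ) ^ 6 * c.M (i + 1) ≤ c.Qr i := by
  have h1 : c.Pr ^ (1 / 10 : ℝ) * c.M (i + 1) ≤ c.Qr i := by
    unfold M Qr
    rw [← Real.rpow_add c.Pr_pos]
    refine Real.rpow_le_rpow_of_exponent_le c.one_le_Pr ?_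
    have := c.one_sub_Sφ_ge hi; have := c.φ_le (J := i + 1) (by omega) hi
    linarith
  exact le_trans (mul_le_mul_of_nonneg_right c.Pr_tenth_ge (c.M_pos _).le) h1

/-- The hypothesis `16 s² p ≤ Q` of Lemma 3.2 along the iteration: for `p ≤ η M_{i+1}`,
`16 s² p ≤ ⌊Q_i⌋`. [cite: Ford2002, (3.9) ("> 32 s² P^{φ_{i+1}}")] -/
theorem sixteen_s_sq_le_Qn {i p : ℕ} (hi : i + 1 ≤ c.j) (hp : (p : ℝ) ≤ c.η * c.M (i + 1)) :
    16 * c.s ^ 2 * p ≤ c.Qn i := by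
  refine Nat.le_floor ?_
  have h1 := c.Qr_ge hi
  have hs : (c.s : ℝ) ≤ (c.k : ℝ) ^ 3 := by exact_mod_cast c.s_le
  have hM := (c.M_pos (i + 1)).le
  have hη := c.η_le
  push_cast
  calc 16 * (c.s : ℝ) ^ 2 * p ≤ 16 * ((c.k : ℝ) ^ 3) ^ 2 * (c.η * c.M (i + 1)) := by
        gcongr
    _ ≤ 16 * ((c.k : ℝ) ^ 3) ^ 2 * (3 / 2 * c.M (i + 1)) := by gcongr
    _ = 24 * (c.k : ℝ) ^ 6 * c.M (i + 1) := by ring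
    _ ≤ 25 * (c.k : ℝ) ^ 6 * c.M (i + 1) := by nlinarith [pow_nonneg c.k_pos.le 6]
    _ ≤ c.Qr i := h1

/-- `⌊⌊Q_i⌋/p⌋ ≤ ⌊Q_{i+1}⌋` for `p > M_{i+1}`. [cite: Ford2002, proof of Lemma 3.4 ("the fact that
L_s(P,Q;Φ;p,q,r) is a non-decreasing function of Q")] -/
theorem Qn_div_le {i p : ℕ} (hp : c.M (i + 1) < p) : c.Qn i / p ≤ c.Qn (i + 1) := by
  refine Nat.le_floor ?_
  have hM := c.M_pos (i + 1)
  have hp0 : (0 : ℝ) < p := hM.trans hp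
  calc ((c.Qn i / p : ℕ) : ℝ) ≤ (c.Qn i : ℝ) / p := Nat.cast_div_le
    _ ≤ c.Qr i / p := div_le_div_of_nonneg_right (c.Qn_le_Qr i) hp0.le
    _ ≤ c.Qr i / c.M (i + 1) := div_le_div_of_nonneg_left (c.Qr_pos i).le hM hp.le
    _ = c.Qr (i + 1) := (c.Qr_succ i).symm

/-- For `p > M_j = P^{1/r}`: `p^r > P`. [cite: Ford2002, proof of Lemma 3.4 ("p^r > M_{j−1}^r ≥ P")] -/
theorem P_lt_pow_of_M_lt {p : ℕ} (hp : c.M c.j < p) : (c.P : ℤ) ≤ (p : ℤ) ^ c.r := by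
  have hr0 : c.r ≠ 0 := by have := c.hr4; omega
  have h1 : c.M c.j ^ c.r = c.Pr := by
    unfold M; rw [c.φ_j, one_div, Real.rpow_inv_natCast_pow c.Pr_pos.le hr0]
  have h2 : c.Pr < (p : ℝ) ^ c.r := by
    rw [← h1]; exact pow_lt_pow_left₀ hp (c.M_pos _).le hr0
  unfold Pr at h2
  have : (c.P : ℝ) ≤ (p : ℝ) ^ c.r := h2.le
  exact_mod_cast this

/-! #### `C > 0` and `λ ≥ 0` (forced by the hypothesis and the diagonal solutions) -/

/-- Auxiliary step (elementary consequence of the definitions and the standing hypotheses). [folklore] -/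
theorem one_le_C : 1 ≤ c.C := by
  have h := c.hJ 1 le_rfl
  simp only [Nat.cast_one, Real.one_rpow, mul_one] at h
  have h1 : (1 : ℝ) ≤ (VMV.J (c.k' + 2) (c.n * (c.k' + 2)) (Finset.Icc (1 : ℤ) 1) : ℝ) := by
    have := one_le_J (c.k' + 2) (c.n * (c.k' + 2)) 1 le_rfl
    rw [Nat.cast_one] at this
    exact_mod_cast this
  exact h1.trans h

/-- Auxiliary step (elementary consequence of the definitions and the standing hypotheses). [folklore] -/
theorem C_pos : 0 < c.C := lt_of_lt_of_le one_pos c.one_le_C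

/-- `λ ≥ 0`: otherwise `Q ≤ Q^s ≤ J_{s,k}(Q) ≤ C Q^λ ≤ C` for all `Q`, absurd. [folklore] -/
theorem lam_nonneg : 0 ≤ c.lam := by
  by_contra hneg
  push Not at hneg
  set Q : ℕ := ⌈c.C⌉₊ + 1 with hQ
  have hQ1 : 1 ≤ Q := by omega
  have h := c.hJ Q hQ1
  have hdiag : (Q : ℝ) ≤ (VMV.J c.k (c.n * c.k) (Finset.Icc (1 : ℤ) Q) : ℝ) := by
    have h1 := FordVK.card_pow_mul_J_le c.k (c.n * c.k) 0 (Finset.Icc (1 : ℤ) Q)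
    rw [add_zero, Int.card_Icc] at h1
    have h2 : 1 ≤ VMV.J c.k 0 (Finset.Icc (1 : ℤ) Q) := by
      have := one_le_J c.k 0 Q hQ1; exact this
    have h3 : Q ^ (c.n * c.k) ≤ VMV.J c.k (c.n * c.k) (Finset.Icc (1 : ℤ) Q) := by
      have e : ((Q : ℤ) + 1 - 1).toNat = Q := by simp
      rw [e] at h1
      exact le_trans (Nat.le_mul_of_pos_right _ h2) h1
    have h4 : Q ≤ Q ^ (c.n * c.k) := by
      calc Q = Q ^ 1 := (pow_one _).symm
        _ ≤ Q ^ (c.n * c.k) := Nat.pow_le_pow_right hQ1 (by have := c.one_le_s; unfold s at this; exact this)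
    exact_mod_cast h4.trans h3
  have hpow : (Q : ℝ) ^ c.lam ≤ 1 :=
    Real.rpow_le_one_of_one_le_of_nonpos (by exact_mod_cast hQ1) hneg.le
  have hC := c.C_pos
  have : (Q : ℝ) ≤ c.C := by
    calc (Q : ℝ) ≤ _ := hdiag
      _ ≤ c.C * (Q : ℝ) ^ c.lam := h
      _ ≤ c.C * 1 := mul_le_mul_of_nonneg_left hpow hC.le
      _ = c.C := mul_one _
  have hQgt : c.C < Q := by
    rw [hQ]; push_cast; have := Nat.le_ceil c.C; linarith
  linarith

/-- `J_{s,k}(⌊Q_i⌋) ≤ C Q_i^λ`. [cite: Ford2002, Lemma 3.4 (hypothesis)] -/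
theorem J_Qn_le {i : ℕ} (hi : i ≤ c.j) :
    (VMV.J c.k c.s (Finset.Icc (1 : ℤ) (c.Qn i)) : ℝ) ≤ c.C * c.Qr i ^ c.lam := by
  have h := c.hJ (c.Qn i) (c.one_le_Qn hi)
  refine h.trans (mul_le_mul_of_nonneg_left ?_ c.C_pos.le)
  exact Real.rpow_le_rpow (Nat.cast_nonneg _) (c.Qn_le_Qr i) c.lam_nonneg


/-! #### The prime sets `𝒫_i` -/

/-- **Ford's `𝒫_i`**: `k³` primes in `(M_i, η M_i]` (Lemma 2.1, here from `FordPrimeWindowsPNT`).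
[cite: Ford2002, proof of Lemma 3.4 ("Lemma 2.1 implies that 𝒫_i ⊂ (M_i, ηM_i]")] -/
theorem exists_Ps {i : ℕ} (h1 : 1 ≤ i) (h2 : i ≤ c.j) :
    ∃ Ps : Finset ℕ, Ps.card = c.k ^ 3 ∧ ∀ p ∈ Ps, p.Prime ∧ c.M i < p ∧ (p : ℝ) ≤ c.η * c.M i := by
  have hω3 : c.ω ≤ 1 := by linarith [c.hω2]
  have hVM := c.V_le_M h1 h2
  have e : Real.exp (1.5 + 1.5 / c.ω) = Real.exp (3 / 2 + 3 / (2 * c.ω)) := by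
    congr 1; rw [show (1.5 : ℝ) = 3 / 2 by norm_num]; ring
  have hx : max (Real.exp (1.5 + 1.5 / c.ω)) (18 / c.ω * (c.k : ℝ) ^ 3 * Real.log c.k) ≤ c.M i := by
    rw [e]; exact hVM
  obtain ⟨Ps, hcard, hPs⟩ := PrimeWindowsPNT.exists_primes_window_V (k := c.k) c.k_ge c.hω1 hω3 (c.M i) hx
  exact ⟨Ps, hcard, fun p hp => ⟨(hPs p hp).1, (hPs p hp).2.1, (hPs p hp).2.2⟩⟩

/-- A choice of `𝒫_i` (`1 ≤ i ≤ j`; empty otherwise). [cite: Ford2002, proof of Lemma 3.4 (`𝒫_i`)] -/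
def Ps (i : ℕ) : Finset ℕ :=
  if h : 1 ≤ i ∧ i ≤ c.j then Classical.choose (c.exists_Ps h.1 h.2) else ∅

/-- Auxiliary step (elementary consequence of the definitions and the standing hypotheses). [folklore] -/
theorem Ps_spec {i : ℕ} (h1 : 1 ≤ i) (h2 : i ≤ c.j) :
    (c.Ps i).card = c.k ^ 3 ∧ ∀ p ∈ c.Ps i, p.Prime ∧ c.M i < p ∧ (p : ℝ) ≤ c.η * c.M i := by
  unfold Ps; rw [dif_pos ⟨h1, h2⟩]; exact Classical.choose_spec (c.exists_Ps h1 h2)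

/-- Auxiliary step (elementary consequence of the definitions and the standing hypotheses). [folklore] -/
theorem Ps_card {i : ℕ} (h1 : 1 ≤ i) (h2 : i ≤ c.j) : (c.Ps i).card = c.k ^ 3 := (c.Ps_spec h1 h2).1

/-- Auxiliary step (elementary consequence of the definitions and the standing hypotheses). [folklore] -/
theorem Ps_mem {i p : ℕ} (h1 : 1 ≤ i) (h2 : i ≤ c.j) (hp : p ∈ c.Ps i) :
    p.Prime ∧ c.M i < p ∧ (p : ℝ) ≤ c.η * c.M i := (c.Ps_spec h1 h2).2 p hp

/-- Auxiliary step (elementary consequence of the definitions and the standing hypotheses). [folklore] -/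
theorem Ps_nonempty {i : ℕ} (h1 : 1 ≤ i) (h2 : i ≤ c.j) : (c.Ps i).Nonempty := by
  rw [← Finset.card_pos, c.Ps_card h1 h2]; have := c.one_le_k; positivity

/-- Auxiliary step (elementary consequence of the definitions and the standing hypotheses). [folklore] -/
theorem Ps_prime_gt {i : ℕ} (h1 : 1 ≤ i) (h2 : i ≤ c.j) : ∀ p ∈ c.Ps i, p.Prime ∧ c.k' + 2 < p :=
  fun _ hp => ⟨(c.Ps_mem h1 h2 hp).1, c.k_lt_of_M_lt h1 h2 (c.Ps_mem h1 h2 hp).2.1⟩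

/-- Auxiliary step (elementary consequence of the definitions and the standing hypotheses). [folklore] -/
theorem Ps_pos {i p : ℕ} (h1 : 1 ≤ i) (h2 : i ≤ c.j) (hp : p ∈ c.Ps i) : 0 < p := (c.Ps_mem h1 h2 hp).1.pos

/-- An index computation: `J + (k−J)(k−J−1) ≤ k(k−1)` for `J + 1 ≤ k`. [folklore] -/
theorem exp_bound {J k : ℕ} (h : J + 1 ≤ k) : J + (k - J) * (k - J - 1) ≤ k * (k - 1) := by
  obtain ⟨t, rfl⟩ : ∃ t, k = J + t + 1 := ⟨k - J - 1, by omega⟩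
  rw [show J + t + 1 - J = t + 1 by omega, show t + 1 - 1 = t by omega, show J + t + 1 - 1 = J + t by omega]
  nlinarith

/-- **The product hypothesis of Lemma 3.2 along the iteration**: for `T ≤ P^J`,
`T (P−1)^{(k−J)(k−J−1)} < ∏_{p ∈ 𝒫_{J+1}} p` (indeed `≤ P^{k²−k} < P^{k³/(k+1)} ≤ M_{J+1}^{k³}`).
[cite: Ford2002, proof of Lemma 3.2 ("P^{d+(k−d)(k−d−1)} ≤ P^{k²−k} < ∏_{p∈𝒫} p")] -/
theorem prod_hyp {J T : ℕ} (hJ : J + 1 ≤ c.j) (hT : T ≤ c.P ^ J) :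
    T * (c.P - 1) ^ ((c.k' + 2 - J) * (c.k' + 2 - J - 1)) < ∏ p ∈ c.Ps (J + 1), p := by
  have hJk : J + 1 ≤ c.k := by have := c.j_lt_r; have := c.hrk; have := c.k_def; omega
  -- in `ℕ`: `≤ P^{k(k-1)}`
  have h1 : T * (c.P - 1) ^ ((c.k - J) * (c.k - J - 1)) ≤ c.P ^ (c.k * (c.k - 1)) := by
    calc T * (c.P - 1) ^ ((c.k - J) * (c.k - J - 1)) ≤ c.P ^ J * c.P ^ ((c.k - J) * (c.k - J - 1)) :=
          Nat.mul_le_mul hT (Nat.pow_le_pow_left (Nat.sub_le _ _) _)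
      _ = c.P ^ (J + (c.k - J) * (c.k - J - 1)) := (pow_add _ _ _).symm
      _ ≤ c.P ^ (c.k * (c.k - 1)) := Nat.pow_le_pow_right c.one_le_P (exp_bound hJk)
  -- in `ℝ`: `P^{k(k-1)} < M_{J+1}^{k³} ≤ ∏ p`
  have hM := c.M_pos (J + 1)
  have h2 : (c.P : ℝ) ^ (c.k * (c.k - 1)) < c.M (J + 1) ^ (c.k ^ 3) := by
    have e1 : (c.P : ℝ) ^ (c.k * (c.k - 1)) = c.Pr ^ (((c.k * (c.k - 1) : ℕ)) : ℝ) := by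
      unfold Pr; rw [Real.rpow_natCast]
    have e2 : c.M (J + 1) ^ (c.k ^ 3) = c.Pr ^ (c.φ (J + 1) * ((c.k ^ 3 : ℕ) : ℝ)) := by
      unfold M; rw [Real.rpow_mul_natCast c.Pr_pos.le]
    rw [e1, e2]
    refine Real.rpow_lt_rpow_of_exponent_lt c.one_lt_Pr ?_
    have hφ := c.φ_ge (J := J + 1) (by omega) hJ
    have hk := c.k_pos
    have hcast : (((c.k * (c.k - 1) : ℕ)) : ℝ) = (c.k : ℝ) * ((c.k : ℝ) - 1) := by
      rw [Nat.cast_mul, Nat.cast_sub c.one_le_k]; simp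
    rw [hcast, Nat.cast_pow]
    have h3 : 1 / ((c.k : ℝ) + 1) * (c.k : ℝ) ^ 3 ≤ c.φ (J + 1) * (c.k : ℝ) ^ 3 :=
      mul_le_mul_of_nonneg_right hφ (by positivity)
    have h4 : (c.k : ℝ) * ((c.k : ℝ) - 1) < 1 / ((c.k : ℝ) + 1) * (c.k : ℝ) ^ 3 := by
      rw [one_div, ← div_eq_inv_mul, lt_div_iff₀ (by positivity)]; nlinarith
    linarith
  have h3 : c.M (J + 1) ^ (c.k ^ 3) ≤ ((∏ p ∈ c.Ps (J + 1), p : ℕ) : ℝ) := by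
    rw [Nat.cast_prod, ← c.Ps_card (i := J + 1) (by omega) hJ, ← Finset.prod_const]
    exact Finset.prod_le_prod (fun _ _ => hM.le) fun p hp => (c.Ps_mem (by omega) hJ hp).2.1.le
  have h4 : ((T * (c.P - 1) ^ ((c.k - J) * (c.k - J - 1)) : ℕ) : ℝ) < ((∏ p ∈ c.Ps (J + 1), p : ℕ) : ℝ) := by
    calc ((T * (c.P - 1) ^ ((c.k - J) * (c.k - J - 1)) : ℕ) : ℝ) ≤ ((c.P ^ (c.k * (c.k - 1)) : ℕ) : ℝ) := by
          exact_mod_cast h1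
      _ = (c.P : ℝ) ^ (c.k * (c.k - 1)) := by push_cast; ring
      _ < _ := h2.trans_le h3
  exact_mod_cast h4

/-! #### The two exponent identities -/

/-- Auxiliary step (elementary consequence of the definitions and the standing hypotheses). [folklore] -/
theorem cast_half : (((c.k * (c.k + 1) / 2 : ℕ)) : ℝ) = (c.k : ℝ) * ((c.k : ℝ) + 1) / 2 := by
  have h : 2 ∣ c.k * (c.k + 1) := (Nat.even_mul_succ_self c.k).two_dvd
  rw [Nat.cast_div h (by norm_num)]; push_cast; ring

/-- `λ = 2s − k(k+1)/2 + Δ`. [cite: Ford2002, proof of Lemma 3.4 ("Let λ = 2s − ½k(k+1) + Δ")] -/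
theorem lam_eq : c.lam = 2 * (c.s : ℝ) - (c.k : ℝ) * ((c.k : ℝ) + 1) / 2 + c.Δ := by
  unfold lam expo; rw [c.cast_half]; unfold s; rfl

/-- **The key identity** `P^{k/2 − krφ_J} M_{J+1}^{s − λ/2 + (r²−r+J²−J)/4} = 1`, in the squared and
multiplied-out form used below:
`M_J^{−2rk} M_{J+1}^{2s + C(r,2) + C(J,2)} P^k Q_{J+1}^λ = Q_J^λ`. [cite: Ford2002, proof of Lemma 3.4
("By the definition of φ_i, k/2 − krφ_J + ½(k(k+1)/2 − Δ + ½(r²−r+J²−J))φ_{J+1} = 0")] -/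
theorem key_identity {J : ℕ} (hJ1 : 1 ≤ J) (hJ : J < c.j) :
    ((c.M J) ^ (2 * c.r * c.k))⁻¹ * c.M (J + 1) ^ (2 * c.s + (c.r.choose 2 + J.choose 2)) * c.Pr ^ c.k
      * c.Qr (J + 1) ^ c.lam = c.Qr J ^ c.lam := by
  have hP := c.Pr_pos
  have hP0 := hP.le
  unfold M Qr
  rw [← Real.rpow_mul_natCast hP0, ← Real.rpow_neg hP0, ← Real.rpow_mul_natCast hP0, ← Real.rpow_natCast,
    ← Real.rpow_mul hP0, ← Real.rpow_mul hP0, ← Real.rpow_add hP, ← Real.rpow_add hP, ← Real.rpow_add hP]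
  congr 1
  have hrec : c.φ J = 1 / (2 * (c.r : ℝ)) +
      (2 * (c.k : ℝ) * c.r + (J : ℝ) ^ 2 - J - (2 * c.Δ - ((c.k : ℝ) - c.r) * ((c.k : ℝ) - c.r + 1))) / (4 * c.k * c.r)
        * c.φ (J + 1) := phiF_rec (c.k : ℝ) c.r c.Δ c.j hJ1 hJ
  rw [c.Sφ_succ, hrec, c.lam_eq]
  have hr := c.r_pos
  have hk := c.k_pos
  push_cast
  rw [Nat.cast_choose_two, Nat.cast_choose_two]
  field_simp
  ring

/-- **The exponent of the conclusion**: `M_1^{2s + C(r,2)} P^k Q_1^λ = P^{2(s+k) − k(k+1)/2 + Δ'}`,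
`Δ' = Δ(1−φ_1) − k + ½φ_1(k²+k+r²−r)`. [cite: Ford2002, proof of Lemma 3.4 (last display)] -/
theorem final_exponent :
    c.M 1 ^ (2 * c.s + (c.r.choose 2 + (0 : ℕ).choose 2)) * c.Pr ^ c.k * c.Qr 1 ^ c.lam
      = c.Pr ^ expo c.k (c.n + 1) (dnext (c.k : ℝ) c.r c.Δ c.j) := by
  have hP := c.Pr_pos
  have hP0 := hP.le
  unfold M Qr
  rw [← Real.rpow_mul_natCast hP0, ← Real.rpow_natCast, ← Real.rpow_mul hP0, ← Real.rpow_add hP,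
    ← Real.rpow_add hP]
  congr 1
  rw [expo_succ c.k c.n _ c.Δ, c.Sφ_one, dnext]
  have e : expo c.k c.n c.Δ = c.lam := rfl
  rw [e, c.lam_eq]
  have eφ : phiF (c.k : ℝ) c.r c.Δ c.j 1 = c.φ 1 := rfl
  rw [eφ]
  push_cast
  rw [Nat.cast_choose_two, Nat.choose_zero_succ]
  push_cast
  ring

/-! #### The majorants `A_J` -/

/-- Auxiliary step (elementary consequence of the definitions and the standing hypotheses). [folklore] -/
theorem A_pos (J : ℕ) : 0 < c.A J := by unfold A; have := c.k_pos; have := c.η_pos; positivity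

/-- Auxiliary step (elementary consequence of the definitions and the standing hypotheses). [folklore] -/
theorem k_pow_le_A (J : ℕ) : (c.k : ℝ) ^ (2 * c.k) ≤ c.A J := by
  unfold A
  have h : (1 : ℝ) ≤ c.η ^ (2 * c.s + (c.k).choose 2 + gq J) := c.one_le_η_pow _
  have := pow_nonneg c.k_pos.le (2 * c.k)
  nlinarith

/-- Auxiliary step (elementary consequence of the definitions and the standing hypotheses). [folklore] -/
theorem one_le_A (J : ℕ) : 1 ≤ c.A J := by
  refine le_trans ?_ (c.k_pow_le_A J)
  have := pow_le_pow_left₀ zero_le_one (by linarith [c.k_geR] : (1 : ℝ) ≤ c.k) (2 * c.k)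
  rwa [one_pow] at this

/-- `A_J² = k^{2k} η^{2s + C(k,2) + C(J+1,2)} A_{J+1}` (the recursion of Ford's `E_J`, with equality).
[cite: Ford2002, proof of Lemma 3.4 (definition of `E_{J−1}`)] -/
theorem A_sq (J : ℕ) :
    c.A J ^ 2 = (c.k : ℝ) ^ (2 * c.k) * c.η ^ (2 * c.s + (c.k).choose 2 + (J + 1).choose 2) * c.A (J + 1) := by
  unfold A
  have h := choose_two_add_gq J
  have e : (2 * c.s + (c.k).choose 2 + gq J) * 2
      = (2 * c.s + (c.k).choose 2 + (J + 1).choose 2) + (2 * c.s + (c.k).choose 2 + gq (J + 1)) := by omega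
  rw [mul_pow, ← pow_mul, ← pow_mul, e, pow_add]
  ring

/-- `2^k k^k ≤ A_J` (the case `U₀` of Lemma 3.3 is absorbed). [cite: Ford2002, proof of Lemma 3.4
("L_s ≤ CQ_J^λ (kP)^k max(2^k, E_J^{1/2} η^{…})")] -/
theorem two_pow_mul_le_A (J : ℕ) : (2 : ℝ) ^ c.k * (c.k : ℝ) ^ c.k ≤ c.A J := by
  refine le_trans ?_ (c.k_pow_le_A J)
  have h2k : (2 : ℝ) ≤ c.k := by linarith [c.k_geR]
  have h1 : (2 : ℝ) ^ c.k ≤ (c.k : ℝ) ^ c.k := pow_le_pow_left₀ (by norm_num) h2k c.k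
  calc (2 : ℝ) ^ c.k * (c.k : ℝ) ^ c.k ≤ (c.k : ℝ) ^ c.k * (c.k : ℝ) ^ c.k :=
        mul_le_mul_of_nonneg_right h1 (pow_nonneg c.k_pos.le _)
    _ = (c.k : ℝ) ^ (2 * c.k) := by rw [← sq, ← pow_mul, mul_comm c.k 2]

/-- The constant comparison in the case `U₁`:
`16·4^k·k³·k!·η^{2s + C(r,2) + C(J,2)} ≤ k^{2k} η^{2s + C(k,2) + C(J,2)}`. [cite: Ford2002, proof of
Lemma 3.4 ("Since r ≤ k and 4(k³k!)^{1/2} ≤ 2^{−k}k^k")] -/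
theorem const_U1 (J : ℕ) :
    16 * (4 : ℝ) ^ c.k * (c.k : ℝ) ^ 3 * (c.k.factorial : ℝ) * c.η ^ (2 * c.s + (c.r.choose 2 + J.choose 2))
      ≤ (c.k : ℝ) ^ (2 * c.k) * c.η ^ (2 * c.s + (c.k).choose 2 + J.choose 2) := by
  have h1 : 16 * (4 : ℝ) ^ c.k * (c.k : ℝ) ^ 3 * (c.k.factorial : ℝ) ≤ (c.k : ℝ) ^ (2 * c.k) := by
    exact_mod_cast sixteen_four_pow_cube_factorial_le c.k_ge
  have h2 : c.η ^ (2 * c.s + (c.r.choose 2 + J.choose 2)) ≤ c.η ^ (2 * c.s + (c.k).choose 2 + J.choose 2) := by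
    refine pow_le_pow_right₀ c.one_le_η ?_
    have : c.r.choose 2 ≤ c.k.choose 2 := Nat.choose_le_choose 2 c.hrk
    omega
  exact mul_le_mul h1 h2 (by have := c.η_pos; positivity) (by have := c.k_pos; positivity)

/-! #### The induction (3.10) -/

/-- **(3.10)** (with `A_J` for `E_J`): for every system `Φ` of type `(J,T)`, `1 ≤ T ≤ P^J`, every
`p ∈ 𝒫_{J+1}` and every `q ≠ 0`, `L_s(P, Q_{J+1}; Φ; p, q, r) ≤ A_J C P^k Q_{J+1}^λ`.
[cite: Ford2002, (3.10)] -/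
def H (J : ℕ) : Prop :=
  ∀ (Φ : PSystem c.k) (T m : ℕ), IsType Φ J T m → 1 ≤ T → T ≤ c.P ^ J →
    ∀ p ∈ c.Ps (J + 1), ∀ q : ℤ, q ≠ 0 →
      (Ls c.s c.P (c.Qn (J + 1)) Φ p q c.r : ℝ) ≤ c.A J * c.C * c.Pr ^ c.k * c.Qr (J + 1) ^ c.lam

/-- **Base case `J = j − 1`**: `p^r > P` forces `w = z`, so `L_s ≤ P^k J_{s,k}(Q_j) ≤ C P^k Q_j^λ`.
[cite: Ford2002, proof of Lemma 3.4 ("First, when J = j−1, … L_s(P,Q_j;φ;p,q,r) ≤ P^k J_{s,k}(Q_j)")] -/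
theorem H_base : c.H (c.j - 1) := by
  intro Φ T m hΦ hT hTP p hp q hq
  have ej : c.j - 1 + 1 = c.j := Nat.sub_add_cancel c.one_le_j
  rw [ej] at hp ⊢
  have hpm := c.Ps_mem c.one_le_j le_rfl hp
  have hp0 : 0 < p := hpm.1.pos
  have hpq : (p : ℤ) * q ≠ 0 := mul_ne_zero (by exact_mod_cast hp0.ne') hq
  have h1 := Ls_le_pow_mul_J c.s c.P (c.Qn c.j) Φ c.r hpq (c.P_lt_pow_of_M_lt hpm.2.1)
  have h2 := c.J_Qn_le (i := c.j) le_rfl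
  have hA := c.one_le_A (c.j - 1)
  have hrest : 0 ≤ c.C * c.Pr ^ c.k * c.Qr c.j ^ c.lam := by
    have := c.C_pos; have := c.Pr_pos; have := c.Qr_pos c.j; positivity
  calc (Ls c.s c.P (c.Qn c.j) Φ p q c.r : ℝ) ≤ ((c.P ^ c.k * VMV.J c.k c.s (Finset.Icc (1 : ℤ) (c.Qn c.j)) : ℕ) : ℝ) := by
        exact_mod_cast h1
    _ = c.Pr ^ c.k * (VMV.J c.k c.s (Finset.Icc (1 : ℤ) (c.Qn c.j)) : ℝ) := by unfold Pr; push_cast; ring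
    _ ≤ c.Pr ^ c.k * (c.C * c.Qr c.j ^ c.lam) := mul_le_mul_of_nonneg_left h2 (pow_nonneg c.Pr_pos.le _)
    _ = 1 * (c.C * c.Pr ^ c.k * c.Qr c.j ^ c.lam) := by ring
    _ ≤ c.A (c.j - 1) * (c.C * c.Pr ^ c.k * c.Qr c.j ^ c.lam) := mul_le_mul_of_nonneg_right hA hrest
    _ = _ := by ring

/-- **Inductive step `J → J − 1`** (`1 ≤ J ≤ j − 1`): Lemma 3.3, then Lemma 3.2 with the primes
`𝒫_{J+1}`, monotonicity in `Q`, the induction hypothesis, and the key identity. [cite: Ford2002, proof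
of Lemma 3.4 ("Now suppose 1 ≤ J ≤ j−1 and (3.10) holds … i.e., (3.10) follows with J replaced by J−1")] -/
theorem H_step {J : ℕ} (hJ1 : 1 ≤ J) (hJj : J + 1 ≤ c.j) (ih : c.H J) : c.H (J - 1) := by
  intro Φ T m hΦ hT hTP p hp q hq
  have eJ : J - 1 + 1 = J := Nat.sub_add_cancel hJ1
  rw [eJ] at hp ⊢
  have hJj' : J ≤ c.j := by omega
  -- the prime `p ∈ 𝒫_J`
  have hpm := c.Ps_mem hJ1 hJj' hp
  have hp0 : 0 < p := hpm.1.pos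
  have hp0R : (0 : ℝ) < p := by exact_mod_cast hp0
  have hpq : (p : ℤ) * q ≠ 0 := mul_ne_zero (by exact_mod_cast hp0.ne') hq
  have hkpos := c.k_pos
  have hηpos := c.η_pos
  have hMJ1 := c.M_pos (J + 1)
  have hCpos := c.C_pos
  have hPrpos := c.Pr_pos
  set Q := c.Qn J with hQdef
  have hQ1 : 1 ≤ Q := c.one_le_Qn hJj'
  -- Lemma 3.3
  obtain ⟨Υ, ⟨T', m', hΥ, hTT', hT'⟩, hL⟩ :=
    ford_lemma33 (k' := c.k') (d := J - 1) c.s c.P Q c.one_le_P Φ hΦ hT hp0 hq c.r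
  rw [eJ] at hΥ
  have hT'1 : 1 ≤ T' := hT.trans hTT'
  have hT'P : T' ≤ c.P ^ J := by
    refine hT'.trans ?_
    calc c.P * T ≤ c.P * c.P ^ (J - 1) := Nat.mul_le_mul_left _ hTP
      _ = c.P ^ J := by rw [← pow_succ', eJ]
  -- Lemma 3.2 for `Υ` with the primes `𝒫_{J+1}`
  have hsJ : J ≤ c.s := by have := c.j_lt_r; have := c.hrk; have := c.k_le_s; have := c.k_def; omega
  obtain ⟨e, he⟩ : ∃ e, c.s = J + e := ⟨c.s - J, by omega⟩
  have hJr : J + 1 ≤ c.r := by have := c.j_lt_r; omega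
  have hQp : ∀ p' ∈ c.Ps (J + 1), 16 * (J + e) ^ 2 * p' ≤ Q := fun p' hp' => by
    rw [← he]; exact c.sixteen_s_sq_le_Qn hJj (c.Ps_mem (by omega) hJj hp').2.2
  obtain ⟨p', hp', Φ', ⟨m'', hΦ'⟩, hK⟩ := ford_lemma32 (k' := c.k') (d := J) (e := e) (r := c.r)
    (by omega) hJr c.hrk c.P Q c.four_k4_lt_P hQ1 hpq Υ hΥ hT'1 (c.Ps (J + 1))
    (c.Ps_prime_gt (by omega) hJj) (c.Ps_nonempty (by omega) hJj) (c.prod_hyp hJj hT'P) hQp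
  rw [← he, c.Ps_card (by omega) hJj] at hK
  have hpm' := c.Ps_mem (i := J + 1) (by omega) hJj hp'
  have hp'0R : (0 : ℝ) ≤ p' := Nat.cast_nonneg _
  -- monotonicity in `Q` and the induction hypothesis
  have hLs' : (Ls c.s c.P (Q / p') Φ' p' ((p : ℤ) * q) c.r : ℝ) ≤ c.A J * c.C * c.Pr ^ c.k * c.Qr (J + 1) ^ c.lam := by
    have hmono := Ls_mono (s := c.s) (P := c.P) (c.Qn_div_le (i := J) hpm'.2.1) Φ' p' ((p : ℤ) * q) c.r
    have hih := ih Φ' T' m'' hΦ' hT'1 hT'P p' hp' ((p : ℤ) * q) hpq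
    exact le_trans (by exact_mod_cast hmono) hih
  -- the bound for `K_s(P,Q_J;Υ;pq)`
  set a : ℕ := 2 * c.s + (c.r.choose 2 + J.choose 2) with ha
  set R : ℝ := c.A J * c.C * c.Pr ^ c.k * c.Qr (J + 1) ^ c.lam with hR
  have hR0 : 0 ≤ R := by
    have := c.A_pos J; have := c.C_pos; have := c.Pr_pos; have := c.Qr_pos (J + 1); positivity
  have hKv : (Ks c.s c.P Q Υ ((p : ℤ) * q) : ℝ)
      ≤ 4 * (c.k : ℝ) ^ 3 * (c.k.factorial : ℝ) * (c.η * c.M (J + 1)) ^ a * R := by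
    have h1 : (Ks c.s c.P Q Υ ((p : ℤ) * q) : ℝ)
        ≤ 4 * (c.k : ℝ) ^ 3 * (c.k.factorial : ℝ) * (p' : ℝ) ^ a * (Ls c.s c.P (Q / p') Φ' p' ((p : ℤ) * q) c.r : ℝ) := by
      have : ((Ks c.s c.P Q Υ ((p : ℤ) * q) : ℕ) : ℝ)
          ≤ ((4 * c.k ^ 3 * (c.k' + 2).factorial * p' ^ a * Ls c.s c.P (Q / p') Φ' p' ((p : ℤ) * q) c.r : ℕ) : ℝ) := by
        exact_mod_cast hK
      refine this.trans (le_of_eq ?_)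
      push_cast; ring
    have h2 : (p' : ℝ) ^ a ≤ (c.η * c.M (J + 1)) ^ a := pow_le_pow_left₀ hp'0R hpm'.2.2 a
    calc _ ≤ _ := h1
      _ ≤ 4 * (c.k : ℝ) ^ 3 * (c.k.factorial : ℝ) * (c.η * c.M (J + 1)) ^ a * R := by
          have := c.k_pos
          exact mul_le_mul (mul_le_mul_of_nonneg_left h2 (by positivity)) hLs' (Nat.cast_nonneg _) (by positivity)
  -- `J_{s,k}(Q_J) ≤ C Q_J^λ`
  have hJv := c.J_Qn_le hJj'
  rw [← hQdef] at hJv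
  -- target
  set Y : ℝ := c.A (J - 1) * c.C * c.Pr ^ c.k * c.Qr J ^ c.lam with hY
  have hY0 : 0 ≤ Y := by
    have := c.A_pos (J - 1); have := c.C_pos; have := c.Pr_pos; have := c.Qr_pos J; positivity
  have ek : ((c.k' : ℝ) + 2) = (c.k : ℝ) := by push_cast; ring
  rw [ek] at hL
  have ePr : (c.P : ℝ) = c.Pr := rfl
  rw [ePr] at hL
  refine hL.trans ?_
  rw [mul_max_of_nonneg _ _ (by have := c.Pr_pos; positivity)]
  refine max_le ?_ ?_
  · -- the case `U₀`: `(2P)^k k^k J ≤ 2^k k^k C P^k Q_J^λ ≤ A_{J-1} C P^k Q_J^λ`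
    have hA := c.two_pow_mul_le_A (J - 1)
    have hrest : 0 ≤ c.C * c.Pr ^ c.k * c.Qr J ^ c.lam := by
      have := c.C_pos; have := c.Pr_pos; have := c.Qr_pos J; positivity
    calc (2 * c.Pr) ^ c.k * ((c.k : ℝ) ^ c.k * (VMV.J (c.k' + 2) c.s (Finset.Icc (1 : ℤ) Q) : ℝ))
        ≤ (2 * c.Pr) ^ c.k * ((c.k : ℝ) ^ c.k * (c.C * c.Qr J ^ c.lam)) := by
          have := c.Pr_pos; have := c.k_pos
          exact mul_le_mul_of_nonneg_left (mul_le_mul_of_nonneg_left hJv (by positivity)) (by positivity)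
      _ = (2 ^ c.k * (c.k : ℝ) ^ c.k) * (c.C * c.Pr ^ c.k * c.Qr J ^ c.lam) := by rw [mul_pow]; ring
      _ ≤ c.A (J - 1) * (c.C * c.Pr ^ c.k * c.Qr J ^ c.lam) := mul_le_mul_of_nonneg_right hA hrest
      _ = Y := by rw [hY]; ring
  · -- the case `U₁`: compare squares
    set X : ℝ := (2 * c.Pr) ^ c.k * (2 * ((p : ℝ) ^ (c.r * c.k))⁻¹ *
      Real.sqrt ((VMV.J (c.k' + 2) c.s (Finset.Icc (1 : ℤ) Q) : ℝ) * (Ks c.s c.P Q Υ ((p : ℤ) * q) : ℝ))) with hX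
    have hX0 : 0 ≤ X := by have := c.Pr_pos; positivity
    rw [← sq_le_sq₀ hX0 hY0]
    -- `X²`
    have hJK0 : 0 ≤ (VMV.J (c.k' + 2) c.s (Finset.Icc (1 : ℤ) Q) : ℝ) * (Ks c.s c.P Q Υ ((p : ℤ) * q) : ℝ) := by positivity
    have e4 : (2 : ℝ) ^ (2 * c.k) = 4 ^ c.k := by rw [pow_mul]; norm_num
    have hX2 : X ^ 2 = 4 ^ c.k * c.Pr ^ (2 * c.k) * 4 * (((p : ℝ) ^ (c.r * c.k))⁻¹) ^ 2 *
        ((VMV.J (c.k' + 2) c.s (Finset.Icc (1 : ℤ) Q) : ℝ) * (Ks c.s c.P Q Υ ((p : ℤ) * q) : ℝ)) := by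
      rw [hX]; simp only [mul_pow]
      rw [Real.sq_sqrt hJK0, ← pow_mul, ← pow_mul, mul_comm c.k 2, e4]
      ring
    -- `(p^{rk})^{-2} ≤ (M_J^{2rk})^{-1}`
    have hMJ := c.M_pos J
    have hpinv : (((p : ℝ) ^ (c.r * c.k))⁻¹) ^ 2 ≤ ((c.M J) ^ (2 * c.r * c.k))⁻¹ := by
      rw [inv_pow, ← pow_mul, show c.r * c.k * 2 = 2 * c.r * c.k by ring]
      exact inv_anti₀ (pow_pos hMJ _) (pow_le_pow_left₀ hMJ.le hpm.2.1.le _)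
    -- `Y²`
    have hY2 : Y ^ 2 = (c.k : ℝ) ^ (2 * c.k) * c.η ^ (2 * c.s + (c.k).choose 2 + J.choose 2) * c.A J *
        c.C ^ 2 * c.Pr ^ (2 * c.k) * (c.Qr J ^ c.lam) ^ 2 := by
      have hA2 := c.A_sq (J - 1)
      rw [eJ] at hA2
      rw [hY]; simp only [mul_pow]; rw [hA2]; ring
    -- assemble `X² ≤ 16·4^k k³ k! η^a A_J C² P^{2k} (Q_J^λ)²`
    have hkey := c.key_identity hJ1 (by omega)
    have hC := c.C_pos
    have hPr := c.Pr_pos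
    have hQJ := c.Qr_pos J
    have hstep1 : X ^ 2 ≤ 4 ^ c.k * c.Pr ^ (2 * c.k) * 4 * ((c.M J) ^ (2 * c.r * c.k))⁻¹ *
        ((c.C * c.Qr J ^ c.lam) * (4 * (c.k : ℝ) ^ 3 * (c.k.factorial : ℝ) * (c.η * c.M (J + 1)) ^ a * R)) := by
      rw [hX2]
      have h1 : ((VMV.J (c.k' + 2) c.s (Finset.Icc (1 : ℤ) Q) : ℝ) * (Ks c.s c.P Q Υ ((p : ℤ) * q) : ℝ))
          ≤ (c.C * c.Qr J ^ c.lam) * (4 * (c.k : ℝ) ^ 3 * (c.k.factorial : ℝ) * (c.η * c.M (J + 1)) ^ a * R) :=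
        mul_le_mul hJv hKv (Nat.cast_nonneg _) (by positivity)
      have h0 : 0 ≤ (c.C * c.Qr J ^ c.lam) * (4 * (c.k : ℝ) ^ 3 * (c.k.factorial : ℝ) * (c.η * c.M (J + 1)) ^ a * R) := by
        have := c.k_pos; have := c.η_pos; have := c.M_pos (J + 1); positivity
      calc 4 ^ c.k * c.Pr ^ (2 * c.k) * 4 * (((p : ℝ) ^ (c.r * c.k))⁻¹) ^ 2 *
            ((VMV.J (c.k' + 2) c.s (Finset.Icc (1 : ℤ) Q) : ℝ) * (Ks c.s c.P Q Υ ((p : ℤ) * q) : ℝ))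
          ≤ 4 ^ c.k * c.Pr ^ (2 * c.k) * 4 * (((p : ℝ) ^ (c.r * c.k))⁻¹) ^ 2 *
            ((c.C * c.Qr J ^ c.lam) * (4 * (c.k : ℝ) ^ 3 * (c.k.factorial : ℝ) * (c.η * c.M (J + 1)) ^ a * R)) :=
            mul_le_mul_of_nonneg_left h1 (by positivity)
        _ ≤ _ := by
            refine mul_le_mul_of_nonneg_right ?_ h0
            exact mul_le_mul_of_nonneg_left hpinv (by positivity)
    have hstep2 : 4 ^ c.k * c.Pr ^ (2 * c.k) * 4 * ((c.M J) ^ (2 * c.r * c.k))⁻¹ *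
        ((c.C * c.Qr J ^ c.lam) * (4 * (c.k : ℝ) ^ 3 * (c.k.factorial : ℝ) * (c.η * c.M (J + 1)) ^ a * R))
        = (16 * (4 : ℝ) ^ c.k * (c.k : ℝ) ^ 3 * (c.k.factorial : ℝ) * c.η ^ a) * c.A J * c.C ^ 2 * c.Pr ^ (2 * c.k)
          * (c.Qr J ^ c.lam) ^ 2 := by
      rw [hR, ← hkey, mul_pow]; ring
    rw [hY2]
    refine hstep1.trans ?_
    rw [hstep2]
    have hconst := c.const_U1 J
    have hrest : 0 ≤ c.A J * c.C ^ 2 * c.Pr ^ (2 * c.k) * (c.Qr J ^ c.lam) ^ 2 := by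
      have := c.A_pos J; positivity
    calc (16 * (4 : ℝ) ^ c.k * (c.k : ℝ) ^ 3 * (c.k.factorial : ℝ) * c.η ^ a) * c.A J * c.C ^ 2 * c.Pr ^ (2 * c.k)
          * (c.Qr J ^ c.lam) ^ 2
        = (16 * (4 : ℝ) ^ c.k * (c.k : ℝ) ^ 3 * (c.k.factorial : ℝ) * c.η ^ a) *
            (c.A J * c.C ^ 2 * c.Pr ^ (2 * c.k) * (c.Qr J ^ c.lam) ^ 2) := by ring
      _ ≤ ((c.k : ℝ) ^ (2 * c.k) * c.η ^ (2 * c.s + (c.k).choose 2 + J.choose 2)) *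
            (c.A J * c.C ^ 2 * c.Pr ^ (2 * c.k) * (c.Qr J ^ c.lam) ^ 2) := mul_le_mul_of_nonneg_right hconst hrest
      _ = _ := by ring

/-- **(3.10) for all `J ≤ j − 1`.** [cite: Ford2002, (3.10)] -/
theorem H_all : ∀ m : ℕ, m + 1 ≤ c.j → c.H (c.j - 1 - m) := by
  intro m
  induction m with
  | zero => intro _; exact c.H_base
  | succ m ih =>
    intro hm
    have h := c.H_step (J := c.j - 1 - m) (by omega) (by omega) (ih (by omega))
    rwa [show c.j - 1 - m - 1 = c.j - 1 - (m + 1) by omega] at h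

/-- Auxiliary step (elementary consequence of the definitions and the standing hypotheses). [folklore] -/
theorem H_zero : c.H 0 := by
  have h := c.H_all (c.j - 1) (by have := c.one_le_j; omega)
  rwa [show c.j - 1 - (c.j - 1) = 0 by omega] at h

/-! #### The conclusion -/

/-- **Lemma 3.4 for the context, sharp form**:
`J_{s+k,k}(P) ≤ 4k³k! · k^{2k} η^{2s+C(k,2)+2} · η^{2s + C(r,2)} · C · P^{2(s+k) − k(k+1)/2 + Δ'}`.
[cite: Ford2002, proof of Lemma 3.4 ("Finally, taking (3.10) with J = 0 and applying Lemma 3.2 with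
Ψ_j(x) = x^j")] -/
theorem main :
    (VMV.J c.k ((c.n + 1) * c.k) (Finset.Icc (1 : ℤ) c.P) : ℝ) ≤
      4 * (c.k : ℝ) ^ 3 * (c.k.factorial : ℝ) * c.η ^ (2 * c.s + (c.r.choose 2 + (0 : ℕ).choose 2)) * c.A 0 * c.C *
        c.Pr ^ expo c.k (c.n + 1) (dnext (c.k : ℝ) c.r c.Δ c.j) := by
  have hj := c.one_le_j
  have hj2 := c.hj2
  -- `J_{s+k,k}(P) = K_s(P,P;x^j;1)`
  have e1 : (c.n + 1) * c.k = c.k + c.s := by unfold s; ring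
  rw [e1, ← Ks_powSys]
  -- Lemma 3.2 with `d = 0`
  have hQp : ∀ p' ∈ c.Ps (0 + 1), 16 * (0 + c.s) ^ 2 * p' ≤ c.P := fun p' hp' => by
    rw [zero_add, ← c.Qn_zero]; exact c.sixteen_s_sq_le_Qn (i := 0) (by omega) (c.Ps_mem le_rfl (by omega) hp').2.2
  have hprod : 1 * (c.P - 1) ^ ((c.k' + 2 - 0) * (c.k' + 2 - 0 - 1)) < ∏ p ∈ c.Ps (0 + 1), p :=
    c.prod_hyp (J := 0) (T := 1) (by omega) (by simp)
  obtain ⟨p, hp, Φ, ⟨m', hΦ⟩, hK⟩ := ford_lemma32 (k' := c.k') (d := 0) (e := c.s) (r := c.r)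
    (by have := c.one_le_s; omega) (by have := c.hr4; omega) c.hrk c.P c.P c.four_k4_lt_P c.one_le_P
    (q := (1 : ℤ)) one_ne_zero (powSys (c.k' + 2)) (isType_powSys _) le_rfl (c.Ps (0 + 1))
    (c.Ps_prime_gt le_rfl (by omega)) (c.Ps_nonempty le_rfl (by omega)) hprod hQp
  simp only [Nat.zero_add] at hK hp
  rw [c.Ps_card le_rfl (by omega)] at hK
  have hpm := c.Ps_mem (i := 1) le_rfl (by omega) hp
  have hp0 : 0 < p := hpm.1.pos
  -- monotonicity and `H 0`
  have hLs : (Ls c.s c.P (c.P / p) Φ p 1 c.r : ℝ) ≤ c.A 0 * c.C * c.Pr ^ c.k * c.Qr 1 ^ c.lam := by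
    have hdiv : c.P / p ≤ c.Qn 1 := by
      have := c.Qn_div_le (i := 0) (p := p) hpm.2.1; rwa [c.Qn_zero] at this
    have hmono := Ls_mono (s := c.s) (P := c.P) hdiv Φ p (1 : ℤ) c.r
    have hH := c.H_zero Φ 1 m' hΦ le_rfl (by simp) p hp 1 one_ne_zero
    exact le_trans (by exact_mod_cast hmono) hH
  set a : ℕ := 2 * c.s + (c.r.choose 2 + (0 : ℕ).choose 2) with ha
  have h1 : (Ks c.s c.P c.P (powSys (c.k' + 2)) 1 : ℝ)
      ≤ 4 * (c.k : ℝ) ^ 3 * (c.k.factorial : ℝ) * (p : ℝ) ^ a * (Ls c.s c.P (c.P / p) Φ p 1 c.r : ℝ) := by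
    have : ((Ks c.s c.P c.P (powSys (c.k' + 2)) 1 : ℕ) : ℝ)
        ≤ ((4 * c.k ^ 3 * (c.k' + 2).factorial * p ^ a * Ls c.s c.P (c.P / p) Φ p 1 c.r : ℕ) : ℝ) := by
      exact_mod_cast hK
    refine this.trans (le_of_eq ?_)
    push_cast; ring
  have h2 : (p : ℝ) ^ a ≤ (c.η * c.M 1) ^ a := pow_le_pow_left₀ (Nat.cast_nonneg _) hpm.2.2 a
  have hfin := c.final_exponent
  have hk := c.k_pos
  have hη := c.η_pos
  have hM1 := c.M_pos 1
  calc (Ks c.s c.P c.P (powSys (c.k' + 2)) 1 : ℝ)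
      ≤ 4 * (c.k : ℝ) ^ 3 * (c.k.factorial : ℝ) * (p : ℝ) ^ a * (c.A 0 * c.C * c.Pr ^ c.k * c.Qr 1 ^ c.lam) := by
        refine h1.trans (mul_le_mul_of_nonneg_left hLs (by positivity))
    _ ≤ 4 * (c.k : ℝ) ^ 3 * (c.k.factorial : ℝ) * (c.η * c.M 1) ^ a * (c.A 0 * c.C * c.Pr ^ c.k * c.Qr 1 ^ c.lam) := by
        have : 0 ≤ c.A 0 * c.C * c.Pr ^ c.k * c.Qr 1 ^ c.lam := by
          have := c.A_pos 0; have := c.C_pos; have := c.Pr_pos; have := c.Qr_pos 1; positivity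
        exact mul_le_mul_of_nonneg_right (mul_le_mul_of_nonneg_left h2 (by positivity)) this
    _ = 4 * (c.k : ℝ) ^ 3 * (c.k.factorial : ℝ) * c.η ^ a * c.A 0 * c.C * (c.M 1 ^ a * c.Pr ^ c.k * c.Qr 1 ^ c.lam) := by
        rw [mul_pow]; ring
    _ = _ := by rw [ha, hfin]

/-- **The sharp constant**: `4k³k! · η^{2s + C(r,2)} · A_0 ≤ 4k³k! · k^{2k} · η^{4s + k(k−1) + 2}`.
[cite: Ford2002, proof of Lemma 3.4 ("E_0 ≤ k^{2k} η^{2s + ½k² − ½k + 2}")] -/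
theorem const_sharp :
    4 * (c.k : ℝ) ^ 3 * (c.k.factorial : ℝ) * c.η ^ (2 * c.s + (c.r.choose 2 + (0 : ℕ).choose 2)) * c.A 0
      ≤ 4 * (c.k : ℝ) ^ 3 * (c.k.factorial : ℝ) * (c.k : ℝ) ^ (2 * c.k) * c.η ^ (4 * c.s + c.k * (c.k - 1) + 2) := by
  unfold A
  rw [gq_zero, Nat.choose_zero_succ, add_zero]
  have hk := c.k_pos
  have hη := c.one_le_η
  have h1 : c.η ^ (2 * c.s + c.r.choose 2) * c.η ^ (2 * c.s + (c.k).choose 2 + 2) ≤ c.η ^ (4 * c.s + c.k * (c.k - 1) + 2) := by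
    rw [← pow_add]
    refine pow_le_pow_right₀ hη ?_
    have h2 : c.r.choose 2 ≤ c.k.choose 2 := Nat.choose_le_choose 2 c.hrk
    have h3 : c.k.choose 2 * 2 = c.k * (c.k - 1) := choose_two_mul_two c.k
    omega
  have h0 : 0 ≤ 4 * (c.k : ℝ) ^ 3 * (c.k.factorial : ℝ) * (c.k : ℝ) ^ (2 * c.k) := by positivity
  calc 4 * (c.k : ℝ) ^ 3 * (c.k.factorial : ℝ) * c.η ^ (2 * c.s + c.r.choose 2) *
        ((c.k : ℝ) ^ (2 * c.k) * c.η ^ (2 * c.s + (c.k).choose 2 + 2))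
      = (4 * (c.k : ℝ) ^ 3 * (c.k.factorial : ℝ) * (c.k : ℝ) ^ (2 * c.k)) *
          (c.η ^ (2 * c.s + c.r.choose 2) * c.η ^ (2 * c.s + (c.k).choose 2 + 2)) := by ring
    _ ≤ (4 * (c.k : ℝ) ^ 3 * (c.k.factorial : ℝ) * (c.k : ℝ) ^ (2 * c.k)) * c.η ^ (4 * c.s + c.k * (c.k - 1) + 2) :=
        mul_le_mul_of_nonneg_left h1 h0
    _ = _ := by ring

/-- **The printed constant**: `4k³k! · k^{2k} · η^{4s + k(k−1) + 2} ≤ k^{3k} η^{4s + k²}`.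
[cite: Ford2002, proof of Lemma 3.4 ("Lastly, 4k³k! ≤ k^k for k ≥ 11. Therefore …")] -/
theorem const_printed :
    4 * (c.k : ℝ) ^ 3 * (c.k.factorial : ℝ) * (c.k : ℝ) ^ (2 * c.k) * c.η ^ (4 * c.s + c.k * (c.k - 1) + 2)
      ≤ (c.k : ℝ) ^ (3 * c.k) * c.η ^ (4 * c.s + c.k ^ 2) := by
  have h1 : 4 * (c.k : ℝ) ^ 3 * (c.k.factorial : ℝ) ≤ (c.k : ℝ) ^ c.k := by
    exact_mod_cast four_cube_factorial_le c.k_ge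
  have h2 : c.η ^ (4 * c.s + c.k * (c.k - 1) + 2) ≤ c.η ^ (4 * c.s + c.k ^ 2) := by
    refine pow_le_pow_right₀ c.one_le_η ?_
    have : c.k * (c.k - 1) + 2 ≤ c.k ^ 2 := mul_pred_add_two_le_sq c.k (le_trans (by norm_num) c.k_ge)
    omega
  have hk := c.k_pos
  calc 4 * (c.k : ℝ) ^ 3 * (c.k.factorial : ℝ) * (c.k : ℝ) ^ (2 * c.k) * c.η ^ (4 * c.s + c.k * (c.k - 1) + 2)
      = (4 * (c.k : ℝ) ^ 3 * (c.k.factorial : ℝ)) * ((c.k : ℝ) ^ (2 * c.k) * c.η ^ (4 * c.s + c.k * (c.k - 1) + 2)) := by ring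
    _ ≤ (c.k : ℝ) ^ c.k * ((c.k : ℝ) ^ (2 * c.k) * c.η ^ (4 * c.s + c.k ^ 2)) := by
        refine mul_le_mul h1 (mul_le_mul_of_nonneg_left h2 (by positivity)) (by have := c.η_pos; positivity) (by positivity)
    _ = _ := by rw [← mul_assoc, ← pow_add, show c.k + 2 * c.k = 3 * c.k by omega]

/-- **Lemma 3.4 for the context** (sharp and printed forms). [cite: Ford2002, Lemma 3.4] -/
theorem main_sharp :
    (VMV.J c.k ((c.n + 1) * c.k) (Finset.Icc (1 : ℤ) c.P) : ℝ) ≤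
      4 * (c.k : ℝ) ^ 3 * (c.k.factorial : ℝ) * (c.k : ℝ) ^ (2 * c.k) * c.η ^ (4 * c.s + c.k * (c.k - 1) + 2) * c.C *
        c.Pr ^ expo c.k (c.n + 1) (dnext (c.k : ℝ) c.r c.Δ c.j) := by
  have h1 := c.main
  have h2 := c.const_sharp
  have h3 : 0 ≤ c.C := c.C_pos.le
  have h4 : 0 ≤ c.Pr ^ expo c.k (c.n + 1) (dnext (c.k : ℝ) c.r c.Δ c.j) := Real.rpow_nonneg c.Pr_pos.le _
  generalize (c.k.factorial : ℝ) = F at h1 h2 ⊢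
  generalize c.A 0 = A0 at h1 h2 ⊢
  generalize c.Pr ^ expo c.k (c.n + 1) (dnext (c.k : ℝ) c.r c.Δ c.j) = Pe at h1 h2 h4 ⊢
  generalize c.η ^ (2 * c.s + (c.r.choose 2 + (0 : ℕ).choose 2)) = E1 at h1 h2 ⊢
  generalize c.η ^ (4 * c.s + c.k * (c.k - 1) + 2) = E2 at h1 h2 ⊢
  exact h1.trans (mul_le_mul_of_nonneg_right (mul_le_mul_of_nonneg_right h2 h3) h4)

/-- Auxiliary step (elementary consequence of the definitions and the standing hypotheses). [folklore] -/
theorem main_printed :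
    (VMV.J c.k ((c.n + 1) * c.k) (Finset.Icc (1 : ℤ) c.P) : ℝ) ≤
      (c.k : ℝ) ^ (3 * c.k) * c.η ^ (4 * c.s + c.k ^ 2) * c.C *
        c.Pr ^ expo c.k (c.n + 1) (dnext (c.k : ℝ) c.r c.Δ c.j) := by
  have h1 := c.main_sharp
  have h2 := c.const_printed
  have h3 : 0 ≤ c.C := c.C_pos.le
  have h4 : 0 ≤ c.Pr ^ expo c.k (c.n + 1) (dnext (c.k : ℝ) c.r c.Δ c.j) := Real.rpow_nonneg c.Pr_pos.le _
  generalize (c.k.factorial : ℝ) = F at h1 h2 ⊢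
  generalize c.Pr ^ expo c.k (c.n + 1) (dnext (c.k : ℝ) c.r c.Δ c.j) = Pe at h1 h2 h4 ⊢
  generalize c.η ^ (4 * c.s + c.k * (c.k - 1) + 2) = E2 at h1 h2 ⊢
  generalize c.η ^ (4 * c.s + c.k ^ 2) = E3 at h1 h2 ⊢
  exact h1.trans (mul_le_mul_of_nonneg_right (mul_le_mul_of_nonneg_right h2 h3) h4)

end L34Ctx


/-! ### Lemma 3.4 -/

/-- **Ford's Lemma 3.4, sharp form** (`k ≥ 128`, `s = nk ≤ k³`, `1/20 ≤ ω ≤ 1/2`, `η = 1 + ω`,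
`V = max(e^{1.5+1.5/ω}, (18/ω)k³ log k)`): under the hypotheses of Lemma 3.4
(`J_{s,k}(Q) ≤ C Q^{2s−k(k+1)/2+Δ}` for `Q ≥ 1`; `4 ≤ r ≤ k`; `j` with (3.8); all `φ_i ≥ 1/(k+1)`),
for `P ≥ V^{k+1}`,
`J_{s+k,k}(P) ≤ 4k³k! · k^{2k} · η^{4s + k(k−1) + 2} · C · P^{2(s+k) − k(k+1)/2 + Δ'}` — the constant the
printed proof yields before the final roundings `4k³k! ≤ k^k`, `η^{−k+2} ≤ 1`.
[cite: Ford2002, Lemma 3.4 (proof)] -/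
theorem ford_lemma34_sharp {k : ℕ} (hk : 128 ≤ k) {ω : ℝ} (hω1 : 1 / 20 ≤ ω) (hω2 : ω ≤ 1 / 2)
    {n r j : ℕ} {Δ C : ℝ} (hn : 1 ≤ n) (hnk : n * k ≤ k ^ 3) (hr4 : 4 ≤ r) (hrk : r ≤ k) (hj2 : 2 ≤ j)
    (hjr : 10 * j ≤ 9 * r) (h38 : ((j : ℝ) - 1) * ((j : ℝ) - 2) ≤ 2 * Δ - ((k : ℝ) - r) * ((k : ℝ) - r + 1))
    (hφ : ∀ J : ℕ, 1 ≤ J → J ≤ j → 1 / ((k : ℝ) + 1) ≤ phiF k r Δ j J)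
    (hJ : ∀ Q : ℕ, 1 ≤ Q → (VMV.J k (n * k) (Finset.Icc (1 : ℤ) Q) : ℝ) ≤ C * (Q : ℝ) ^ expo k n Δ)
    {P : ℕ} (hP : Vf k ω ^ (k + 1) ≤ (P : ℝ)) :
    (VMV.J k ((n + 1) * k) (Finset.Icc (1 : ℤ) P) : ℝ) ≤
      4 * (k : ℝ) ^ 3 * (k.factorial : ℝ) * (k : ℝ) ^ (2 * k) * (1 + ω) ^ (4 * (n * k) + k * (k - 1) + 2) * C *
        (P : ℝ) ^ expo k (n + 1) (dnext k r Δ j) := by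
  obtain ⟨k', rfl⟩ : ∃ k', k = k' + 2 := ⟨k - 2, by omega⟩
  let c : L34Ctx := ⟨k', n, r, j, P, ω, Δ, C, hk, hω1, hω2, hn, hnk, hr4, hrk, hj2, hjr, h38, hφ, hJ, hP⟩
  exact c.main_sharp

/-- **Ford's Lemma 3.4 (as printed)**, for `k ≥ 128`, `s = nk`, `1/20 ≤ ω ≤ 1/2`:
`J_{s+k,k}(P) ≤ k^{3k} η^{4s+k²} C P^{2(s+k) − k(k+1)/2 + Δ'}` for `P ≥ V^{k+1}`.
[cite: Ford2002, Lemma 3.4] -/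
theorem ford_lemma34 {k : ℕ} (hk : 128 ≤ k) {ω : ℝ} (hω1 : 1 / 20 ≤ ω) (hω2 : ω ≤ 1 / 2)
    {n r j : ℕ} {Δ C : ℝ} (hn : 1 ≤ n) (hnk : n * k ≤ k ^ 3) (hr4 : 4 ≤ r) (hrk : r ≤ k) (hj2 : 2 ≤ j)
    (hjr : 10 * j ≤ 9 * r) (h38 : ((j : ℝ) - 1) * ((j : ℝ) - 2) ≤ 2 * Δ - ((k : ℝ) - r) * ((k : ℝ) - r + 1))
    (hφ : ∀ J : ℕ, 1 ≤ J → J ≤ j → 1 / ((k : ℝ) + 1) ≤ phiF k r Δ j J)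
    (hJ : ∀ Q : ℕ, 1 ≤ Q → (VMV.J k (n * k) (Finset.Icc (1 : ℤ) Q) : ℝ) ≤ C * (Q : ℝ) ^ expo k n Δ)
    {P : ℕ} (hP : Vf k ω ^ (k + 1) ≤ (P : ℝ)) :
    (VMV.J k ((n + 1) * k) (Finset.Icc (1 : ℤ) P) : ℝ) ≤
      (k : ℝ) ^ (3 * k) * (1 + ω) ^ (4 * (n * k) + k ^ 2) * C * (P : ℝ) ^ expo k (n + 1) (dnext k r Δ j) := by
  obtain ⟨k', rfl⟩ : ∃ k', k = k' + 2 := ⟨k - 2, by omega⟩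
  let c : L34Ctx := ⟨k', n, r, j, P, ω, Δ, C, hk, hω1, hω2, hn, hnk, hr4, hrk, hj2, hjr, h38, hφ, hJ, hP⟩
  exact c.main_printed

/-- **The tree's hypothesis `FordP1.Lemma34Hyp k ω` holds** for `k ≥ 128` and `1/20 ≤ ω ≤ 1/2`
(this covers every use in `FordProgram1.lean` (`ω = 0.0745, 0.0727, 0.0694`) and in
`FordTheorem3LargeKOfLemma34.lean` (`ω = 0.06`)). [cite: Ford2002, Lemma 3.4] -/
theorem lemma34Hyp_of {k : ℕ} (hk : 128 ≤ k) {ω : ℝ} (hω1 : 1 / 20 ≤ ω) (hω2 : ω ≤ 1 / 2) :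
    Lemma34Hyp k ω := by
  intro n r j Δ C hn hnk hr4 hrk hj2 hjr h38 hφ hJ P hP
  exact ford_lemma34 hk hω1 hω2 hn hnk hr4 hrk hj2 hjr h38 hφ hJ hP

end FordVK
end Literature.NumberTheory.LFunctions
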